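import Literature.Computability.Cryptography.ChenQuantumLWERobustMeasurement

/-!
# Chen 2024 (withdrawn), Step 8: the ORDER OF THE TOLERANCE of the robust measurement ceiling

REPRODUCTION / ANALYSIS OF A CLAIMED RESULT UNDER ADJUDICATION — header required by the tree's literature
rule.  Author: Yilei Chen.  Title: *Quantum Algorithms for Lattice Problems*.  Venue: IACR Cryptology ePrint
Archive, Paper 2024/555, version of 18 April 2024 (the main claim WITHDRAWN by the author, title-page note;
the bug is in Step 9, p. 37). [ChenQuantumLattice2024]  Printed page numbers.

HONEST FRAMING (bundle `papers/QuantumAdvantage/lwe-quantum-autopsy/`, Part 1, generation 8): the value of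
this file is a set of kernel-checked THEOREMS — a two-sided, quantitative negative result about one step of a
withdrawn algorithm — NOT summit progress and no cryptanalytic claim in either direction (nothing here says
LWE is quantumly easy or hard).

WHAT IS DONE HERE.  `ChenQuantumLWERobustMeasurement.lean` (gen 7) proved the Step-8 ceiling for every POVM
that is `ε`-ALMOST SURE on the class of instances consistent with the public data (`Shape.AlmostSureOn`),
with the tolerance `4·ε·P² < 1`, `P = p₁Q` (register modulus `M = 2D²P`), and left the ORDER of the
admissible tolerance open (its scope note (b)).  This file settles the order in the parameters that matter.
Write `S′ := (b, v′ + 2D²p₁·b)` for the companion instance of `S` (same `b`, same Step-8 output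
`v′₀ mod D²p₁`, different Step-9 need `v′₀ mod D²P`, `Shape.step8_cannot_supply_step9Needs_povm`).

* SUFFICIENCY, SHARPENED (Parts I–III).  Counting ALL coinciding branches of a move instead of one:
  at "level" `(g, q)` with `g·q = Q` the moves `A` (same offsets, `b`'s congruent mod `2p₁g` on the tail),
  `T`, `C` (offset shifts by `2D²p₁·g·(…)`) have `p₁·g·2ⁿ` common points, so normalised overlap `≥ 1/q`
  (`Shape.overlap_of_rigid_family`, `Shape.overlap_same_offset_dvd`, `Shape.overlap_moveT_dvd`,
  `Shape.overlap_moveC_dvd`; gen 7's `1/P` was an undercount).  Hence the chain `C·A·T·A` runs at level `q`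
  under `4·ε·q² < 1` (`Shape.step8_povm_ceiling_dvd`: shifts `v ↦ v + 2D²p₁g(a·b₂ + m)`), a coprime pair
  `Q = A·B` with `4εA² < 1 ∧ 4εB² < 1` gives gen 7's FULL conclusion by Bezout
  (`Shape.step8_povm_ceiling_coprime`), in particular `4·ε·Q² < 1` suffices (`Shape.step8_povm_ceiling_sharp`,
  corollaries `Shape.step8_cannot_supply_step9Needs_povm_sharp{,'}`,
  `Shape.step9Needs_not_almostSurely_measurable_sharp`).
* SUFFICIENCY FROM A BEZOUT FAMILY (Part VIII).  The chain localises completely: two invariances of the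
  almost-certain outcome (`Shape.OffsetInvariant`, `Shape.SlopeInvariant`, generator `G ∈ ℤ`) hold for
  `G = g` at every level with `4εq² < 1` and are closed under `ℤ`-combinations of generators
  (`…_comb`, `…_sum`, through intermediate CLASS instances and `POVM.almostCertain_unique`).  So if
  `(qᵢ)` are divisors of `Q` with `4ε·qᵢ² < 1` each and `∑ cᵢ·(Q/qᵢ) = 1`, the full conclusion holds
  (`Shape.step8_povm_ceiling_family`); e.g. ANY factorisation of `Q` into pairwise coprime factors
  (`Shape.step8_povm_ceiling_pairwiseCoprime`, family Bezout = Mathlib's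
  `exists_sum_eq_one_iff_pairwise_coprime`).  For the source's own parameters (Cond. C.3 p. 18, §3.2:
  `Q = p₂⋯p_κ`, pairwise coprime, `pᵢ ≤ log n`, `κ ∈ O(log n)`) the tolerance is therefore
  `4ε·(max pᵢ)² < 1` — inverse-POLYLOGARITHMIC in `n`, where gen 7's `1/(4P²)` was inverse-quasi-polynomial.
* NECESSITY (Parts IV–VII).  (i) Off the `b`-class the overlap is SMALL: if two admissible instances' `b`'s
  differ at some tail coordinate by `2p₁μ` with `Q ∤ μ`, then `‖⟨φ7₂|φ7₃⟩‖·minFac(Q) ≤ P·2ⁿ`, i.e.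
  normalised overlap `≤ 1/minFac(Q)` (`Shape.norm_dot_phi7_mul_minFac_le`: two coincidences force
  `Q ∣ (j₁ − j₂)·μ`, `Shape.two_coincidences_dvd`, so the carrying branches `j` lie in ONE residue class
  modulo `L = Q/gcd(Q,μ) ≥ minFac Q`, `Shape.card_carrying_branches_le`, and each carries at most one common
  point of modulus-one amplitudes).  (ii) On the `b`-class the overlap is EXACT: `⟨φ7(b,v′)|φ7(b,v)⟩ =
  P·2ⁿ·[v ≡ v′ (mod M)]` (`Shape.dot_phi7_sameB`; a quadratic Gauss-sum-with-shift computation over the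
  branches, `Shape.sum_chirp_shift`, `Shape.sum_kpart`), transported to `b`'s congruent mod `P`
  (`Shape.dot_phi7d_congr_b`).  (iii) The WITNESS: the rank-one measurement `{|ψ⟩⟨ψ|/⟨ψ|ψ⟩, 1 − …}` along
  `ψ = |φ7.d⟩` of `S` (`rankOnePOVM`, a bona fide `POVM`: positivity of the complement is Cauchy–Schwarz)
  is `(1/minFac(Q)²)`-almost sure on EVERY admissible instance, for every class `U`
  (`Shape.rankOne_almostSureOn`), returns outcome `0` on `S` and outcome `1` on `S′` with certainty
  (`Shape.rankOne_separates`; `S ⊥ S′`).  Hence the same-outcome conclusion of the robust ceiling FAILS at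
  `ε₀ = 1/minFac(Q)²` (`Shape.step8_povm_ceiling_fails_at_inv_minFac_sq`).
* THE ORDER.  Writing `ε⋆` for the supremum of the tolerances at which every `ε`-almost-sure POVM gives `S`
  and `S′` the same almost-certain outcome (antitone in `ε`):  `1/(4·q⋆²) ≤ ε⋆ ≤ 1/minFac(Q)²`, where `q⋆`
  is the largest member of the best Bezout family — at most the largest prime-power divisor of `Q`.  For
  PRIME `Q`: `1/(4Q²) ≤ ε⋆ ≤ 1/Q²`, order exactly `1/Q²` (`Shape.step8_povm_ceiling_order_prime`); for
  square-free `Q` with comparable prime factors the two sides agree up to the constant `4·(max p/min p)²`.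

SCOPE (honest).  (a) What is bounded from BOTH sides is the reach of the INDISTINGUISHABILITY-CHAIN method
("`S` and `S′` receive the same outcome"); the necessity witness is a two-outcome measurement that separates
`S` from `S′` but does not itself output any instance's `step9Needs`, so whether `v′₀ mod D²P` becomes
approximately measurable at tolerances `≥ 1/minFac(Q)²` is NOT decided here (Lemma 3.13's own requirement,
exact non-demolition, excludes it regardless).  (b) The exact threshold is not determined: the factor `4`
(the two-state discrimination constant of gen 7) and, for composite `Q` with one dominant prime power, the
gap between `1/(4·q⋆²)` and `1/minFac(Q)²` remain OPEN; no numerics were run.  (c) As in gens 6–7 the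
statements concern the Step-8 register state `|φ7.d⟩` of eq. (35)/§3.5.8 as formalised in
`ChenQuantumLWESteps` / `ChenQuantumLWEStepEight`, for the class `Shape.InClass`; nothing is said about other
algorithms for LWE.  (d) Correction to gen 7's scope note (b): a single move has normalised overlap at least
`1/Q`, not `1/P` (the `p₁` coinciding branch classes `j ≡ j₀ (mod Q)` were not counted there); no statement
of gen 7 is affected, only its constant.

Everything is `sorry`-free over Mathlib and modules (A)–(P) of the bundle (imported, nothing re-proved).
-/

namespace Literature.Computability.Cryptography.Chen2024

open scoped BigOperators ComplexOrder MatrixOrder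
open Matrix

namespace Shape

variable {S : Shape}

/-! ## Part I.  Helpers: `P = p₁Q` as naturals, points modulo `P`, coordinatewise coincidence -/

/-- `P = p₁Q` as a natural number. [cite: ChenQuantumLattice2024, Cond. C.3 p. 18] -/
theorem P_nat : (S.P : ℕ) = S.p₁ * S.Q := by
  show (((S.p₁ * S.Q : ℕ+)) : ℕ) = _
  rw [PNat.mul_coe]

/-- The point of branch `(j,k)` depends on `j` only modulo `P` (`2D²·P = M`). [cite: ChenQuantumLattice2024, eq. (35) p. 31] -/
theorem pt7_inst_mod_P (b v : Fin (S.n + 1) → ℤ) (J : ℕ) (k : Fin S.n → Fin 2) :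
    (S.inst b v).pt7 (J % (S.P : ℕ)) k = (S.inst b v).pt7 J k := by
  funext i
  rw [pt7_inst_apply, pt7_inst_apply]
  refine (ZMod.intCast_eq_intCast_iff_dvd_sub _ _ (S.M : ℕ)).2 ?_
  rw [S.M_coe]
  have hJ : (J : ℤ) % ((S.P : ℕ) : ℤ) = J - ((S.P : ℕ) : ℤ) * ((J : ℤ) / ((S.P : ℕ) : ℤ)) := by
    rw [Int.emod_def]
  refine ⟨b i * ((J : ℤ) / ((S.P : ℕ) : ℤ)), ?_⟩
  push_cast
  linear_combination (-2 * (S.D : ℤ) * S.D * b i) * hJ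

/-- Coordinate `i` of a coincidence of branches with the SAME tail bits `k`, as a divisibility:
`M ∣ 2D²(j′b₃ᵢ − j b₂ᵢ) + (v₃ᵢ − v₂ᵢ)`. [cite: ChenQuantumLattice2024, eq. (35) p. 31] -/
theorem pt7_inst_apply_eq_iff (b₂ v₂ b₃ v₃ : Fin (S.n + 1) → ℤ) (j j' : ℕ) (k : Fin S.n → Fin 2)
    (i : Fin (S.n + 1)) :
    (S.inst b₂ v₂).pt7 j k i = (S.inst b₃ v₃).pt7 j' k i
      ↔ ((S.M : ℕ) : ℤ) ∣ 2 * (S.D : ℤ) * S.D * ((j' : ℤ) * b₃ i - j * b₂ i) + (v₃ i - v₂ i) := by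
  have e : (2 * (S.D : ℤ) * j' * ((S.D : ℤ) * b₃ i) + v₃ i + (S.N : ℤ) * S.kLift k i)
      - (2 * (S.D : ℤ) * j * ((S.D : ℤ) * b₂ i) + v₂ i + (S.N : ℤ) * S.kLift k i)
      = 2 * (S.D : ℤ) * S.D * ((j' : ℤ) * b₃ i - j * b₂ i) + (v₃ i - v₂ i) := by ring
  have key : ((2 * (S.D : ℤ) * j * ((S.D : ℤ) * b₂ i) + v₂ i + (S.N : ℤ) * S.kLift k i : ℤ) : ZMod S.M)
      = ((2 * (S.D : ℤ) * j' * ((S.D : ℤ) * b₃ i) + v₃ i + (S.N : ℤ) * S.kLift k i : ℤ) : ZMod S.M)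
      ↔ ((S.M : ℕ) : ℤ) ∣ (2 * (S.D : ℤ) * j' * ((S.D : ℤ) * b₃ i) + v₃ i + (S.N : ℤ) * S.kLift k i)
          - (2 * (S.D : ℤ) * j * ((S.D : ℤ) * b₂ i) + v₂ i + (S.N : ℤ) * S.kLift k i) :=
    ZMod.intCast_eq_intCast_iff_dvd_sub _ _ _
  rw [e] at key
  exact key

/-! ## Part II.  Quantitative rigidity with a FAMILY of witnesses

`ChenQuantumLWERobustMeasurement.overlap_of_rigid` used ONE pair of coinciding branches `(j₀, j₀′)` and
obtained the normalised overlap `≥ 1/P`.  The moves actually have `p₁` (more generally `p₁·g`) coinciding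
pairs `j ≡ j₀ (mod Q)`; counting all of them gives `≥ 1/Q` (resp. `≥ g/Q`). -/

/-- **Quantitative rigidity, family version.**  Under the rigidity hypothesis of `overlap_of_rigid`
(unimodular `ζ`), if the `R` branch pairs `(c + q·r, c′ + q·r)`, `r < R`, coincide for every tail `k`, where
`R·q = P`, then `⟨ψ₂|ψ₂⟩⟨ψ₃|ψ₃⟩ ≤ q²·‖⟨ψ₂|ψ₃⟩‖²` (normalised overlap `≥ R/P = 1/q`).
[cite: ChenQuantumLattice2024, eq. (35) p. 31, §3.5.8 p. 33] -/
theorem overlap_of_rigid_family {b₂ v₂ b₃ v₃ : Fin (S.n + 1) → ℤ} (h₂ : (S.inst b₂ v₂).Admissible)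
    (h₃ : (S.inst b₃ v₃).Admissible) {ζ : ℂ} (hζ : ‖ζ‖ = 1)
    (hrig : ∀ (j : ℕ) (k : Fin S.n → Fin 2) (j' : ℕ) (k' : Fin S.n → Fin 2), j < (S.P : ℕ) → j' < (S.P : ℕ) →
      (S.inst b₂ v₂).pt7 j k = (S.inst b₃ v₃).pt7 j' k' →
        (starRingEnd ℂ) (S.amp7 j k) * S.amp7 j' k' = ζ)
    {R q : ℕ} (hRq : R * q = (S.P : ℕ)) (c c' : ℕ)
    (hwit : ∀ r, r < R → ∀ k : Fin S.n → Fin 2,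
      (S.inst b₂ v₂).pt7 (c + q * r) k = (S.inst b₃ v₃).pt7 (c' + q * r) k) :
    (star (S.inst b₂ v₂).phi7d ⬝ᵥ (S.inst b₂ v₂).phi7d).re
        * (star (S.inst b₃ v₃).phi7d ⬝ᵥ (S.inst b₃ v₃).phi7d).re
      ≤ (q : ℝ) ^ 2 * ‖star (S.inst b₂ v₂).phi7d ⬝ᵥ (S.inst b₃ v₃).phi7d‖ ^ 2 := by
  have hP0 : 0 < (S.P : ℕ) := S.P.pos
  have hq0 : q ≠ 0 := by
    rintro rfl
    rw [mul_zero] at hRq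
    omega
  -- the rigidity count on `|φ7⟩`
  have hrig' : ∀ z : Fin (S.n + 1) → ZMod S.M, (S.inst b₂ v₂).phi7 z ≠ 0 → (S.inst b₃ v₃).phi7 z ≠ 0 →
      (starRingEnd ℂ) ((S.inst b₂ v₂).phi7 z) * (S.inst b₃ v₃).phi7 z = ζ := by
    intro z hz₂ hz₃
    obtain ⟨j, hj, k, hjk⟩ := (S.inst b₂ v₂).exists_branch_of_phi7_ne_zero hz₂
    obtain ⟨j', hj', k', hjk'⟩ := (S.inst b₃ v₃).exists_branch_of_phi7_ne_zero hz₃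
    have hco : (S.inst b₂ v₂).pt7 j k = (S.inst b₃ v₃).pt7 j' k' := hjk.symm.trans hjk'
    have e₂ : (S.inst b₂ v₂).phi7 z = S.amp7 j k := by
      rw [hjk]
      exact (S.inst b₂ v₂).phi7_apply_pt7 h₂ hj k
    have e₃ : (S.inst b₃ v₃).phi7 z = S.amp7 j' k' := by
      rw [hjk']
      exact (S.inst b₃ v₃).phi7_apply_pt7 h₃ hj' k'
    rw [e₂, e₃]
    exact hrig j k j' k' hj hj' hco
  have hdot : star (S.inst b₂ v₂).phi7 ⬝ᵥ (S.inst b₃ v₃).phi7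
      = ((Finset.univ.filter fun z : Fin (S.n + 1) → ZMod S.M =>
          (S.inst b₂ v₂).phi7 z ≠ 0 ∧ (S.inst b₃ v₃).phi7 z ≠ 0).card : ℂ) * ζ :=
    dotProduct_eq_card_mul_of_rigid _ _ hrig'
  -- at least `R·2ⁿ` coincidences
  have hcount : R * 2 ^ S.n ≤ (Finset.univ.filter fun z : Fin (S.n + 1) → ZMod S.M =>
      (S.inst b₂ v₂).phi7 z ≠ 0 ∧ (S.inst b₃ v₃).phi7 z ≠ 0).card := by
    have hsub : ((Finset.range R) ×ˢ (Finset.univ : Finset (Fin S.n → Fin 2))).image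
        (fun rk => (S.inst b₂ v₂).pt7 ((c + q * rk.1) % (S.P : ℕ)) rk.2)
        ⊆ Finset.univ.filter fun z : Fin (S.n + 1) → ZMod S.M =>
          (S.inst b₂ v₂).phi7 z ≠ 0 ∧ (S.inst b₃ v₃).phi7 z ≠ 0 := by
      intro z hz
      obtain ⟨⟨r, k⟩, hrk, rfl⟩ := Finset.mem_image.1 hz
      have hr : r < R := Finset.mem_range.1 (Finset.mem_product.1 hrk).1
      refine Finset.mem_filter.2 ⟨Finset.mem_univ _, ?_, ?_⟩
      · dsimp only
        rw [(S.inst b₂ v₂).phi7_apply_pt7 h₂ (j := (c + q * r) % (S.P : ℕ)) (Nat.mod_lt _ hP0)]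
        exact (S.inst b₂ v₂).amp7_ne_zero _ k
      · dsimp only
        rw [pt7_inst_mod_P, hwit r hr k, ← pt7_inst_mod_P,
          (S.inst b₃ v₃).phi7_apply_pt7 h₃ (j := (c' + q * r) % (S.P : ℕ)) (Nat.mod_lt _ hP0)]
        exact (S.inst b₃ v₃).amp7_ne_zero _ k
    have hcard : (((Finset.range R) ×ˢ (Finset.univ : Finset (Fin S.n → Fin 2))).image
        (fun rk => (S.inst b₂ v₂).pt7 ((c + q * rk.1) % (S.P : ℕ)) rk.2)).card = R * 2 ^ S.n := by
      rw [Finset.card_image_of_injOn, Finset.card_product, Finset.card_range, Finset.card_univ,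
        Fintype.card_fun, Fintype.card_fin, Fintype.card_fin]
      rintro ⟨r, k⟩ hrk ⟨r', k'⟩ hrk' heq
      simp only [Finset.coe_product, Finset.coe_range, Finset.coe_univ, Set.mem_prod, Set.mem_Iio,
        Set.mem_univ, and_true] at hrk hrk'
      dsimp only at heq
      obtain ⟨hjj, hkk⟩ := (S.inst b₂ v₂).pt7_inj h₂ (j := (c + q * r) % (S.P : ℕ))
        (j' := (c + q * r') % (S.P : ℕ)) (Nat.mod_lt _ hP0) (Nat.mod_lt _ hP0) heq
      have hd : ((S.P : ℕ) : ℤ) ∣ ((c + q * r' : ℕ) : ℤ) - ((c + q * r : ℕ) : ℤ) :=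
        (Nat.modEq_iff_dvd.1 hjj)
      have hd' : ((R : ℤ) * q) ∣ ((r' : ℤ) - r) * q := by
        have e1 : ((c + q * r' : ℕ) : ℤ) - ((c + q * r : ℕ) : ℤ) = ((r' : ℤ) - r) * q := by
          push_cast
          ring
        rw [← e1]
        have e2 : ((R : ℤ) * q) = ((S.P : ℕ) : ℤ) := by exact_mod_cast hRq
        rwa [e2]
      have hqz : (q : ℤ) ≠ 0 := by exact_mod_cast hq0
      have hRd : (R : ℤ) ∣ (r' : ℤ) - r := (mul_dvd_mul_iff_right hqz).1 hd'
      have hrr : r = r' := nat_eq_of_dvd_sub_of_lt hrk hrk' hRd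
      subst hrr
      exact Prod.ext rfl hkk
    rw [← hcard]
    exact Finset.card_le_card hsub
  -- the norms
  have hΛ0 : (0 : ℝ) ≤ (((S.M : ℕ) : ℝ) * (S.D : ℕ)) ^ (S.n + 1) := by positivity
  have hΛC : ((((S.M : ℕ) : ℂ) * (S.D : ℕ)) ^ (S.n + 1))
      = ((((((S.M : ℕ) : ℝ) * (S.D : ℕ)) ^ (S.n + 1) : ℝ)) : ℂ) := by
    push_cast
    ring
  have hPC : (((S.P : ℕ) : ℂ) * 2 ^ S.n) = (((((S.P : ℕ) : ℝ) * 2 ^ S.n) : ℝ) : ℂ) := by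
    push_cast
    ring
  have hN : ∀ {b v : Fin (S.n + 1) → ℤ}, (S.inst b v).Admissible →
      (star (S.inst b v).phi7d ⬝ᵥ (S.inst b v).phi7d).re
        = (((S.M : ℕ) : ℝ) * (S.D : ℕ)) ^ (S.n + 1) * (((S.P : ℕ) : ℝ) * 2 ^ S.n) := by
    intro b v hI
    rw [star_phi7d_dotProduct_phi7d_inst hI, hΛC, hPC, ← Complex.ofReal_mul, Complex.ofReal_re]
  have hO : ‖star (S.inst b₂ v₂).phi7d ⬝ᵥ (S.inst b₃ v₃).phi7d‖
      = (((S.M : ℕ) : ℝ) * (S.D : ℕ)) ^ (S.n + 1)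
        * ((Finset.univ.filter fun z : Fin (S.n + 1) → ZMod S.M =>
            (S.inst b₂ v₂).phi7 z ≠ 0 ∧ (S.inst b₃ v₃).phi7 z ≠ 0).card : ℝ) := by
    rw [dot_phi7d_inst_phi7 b₂ v₂ b₃ v₃ h₃, hΛC, hdot, norm_mul, norm_mul, hζ, mul_one,
      Complex.norm_real, Complex.norm_natCast, Real.norm_of_nonneg hΛ0]
  have hPR : ((S.P : ℕ) : ℝ) = (R : ℝ) * q := by exact_mod_cast hRq.symm
  rw [hN h₂, hN h₃, hO, hPR]
  have hc : (R : ℝ) * 2 ^ S.n ≤ ((Finset.univ.filter fun z : Fin (S.n + 1) → ZMod S.M =>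
      (S.inst b₂ v₂).phi7 z ≠ 0 ∧ (S.inst b₃ v₃).phi7 z ≠ 0).card : ℝ) := by
    exact_mod_cast hcount
  have h20 : (0 : ℝ) ≤ (R : ℝ) * 2 ^ S.n := by positivity
  have htC := mul_le_mul hc hc h20 (h20.trans hc)
  have hsq : (0 : ℝ) ≤ ((((S.M : ℕ) : ℝ) * (S.D : ℕ)) ^ (S.n + 1) * q) ^ 2 := sq_nonneg _
  calc (((S.M : ℕ) : ℝ) * (S.D : ℕ)) ^ (S.n + 1) * ((R : ℝ) * q * 2 ^ S.n)
        * ((((S.M : ℕ) : ℝ) * (S.D : ℕ)) ^ (S.n + 1) * ((R : ℝ) * q * 2 ^ S.n))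
      = ((((S.M : ℕ) : ℝ) * (S.D : ℕ)) ^ (S.n + 1) * q) ^ 2
          * (((R : ℝ) * 2 ^ S.n) * ((R : ℝ) * 2 ^ S.n)) := by ring
    _ ≤ ((((S.M : ℕ) : ℝ) * (S.D : ℕ)) ^ (S.n + 1) * q) ^ 2
        * (((Finset.univ.filter fun z : Fin (S.n + 1) → ZMod S.M =>
            (S.inst b₂ v₂).phi7 z ≠ 0 ∧ (S.inst b₃ v₃).phi7 z ≠ 0).card : ℝ)
          * ((Finset.univ.filter fun z : Fin (S.n + 1) → ZMod S.M =>
            (S.inst b₂ v₂).phi7 z ≠ 0 ∧ (S.inst b₃ v₃).phi7 z ≠ 0).card : ℝ)) :=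
        mul_le_mul_of_nonneg_left htC hsq
    _ = (q : ℝ) ^ 2 * ((((S.M : ℕ) : ℝ) * (S.D : ℕ)) ^ (S.n + 1)
        * ((Finset.univ.filter fun z : Fin (S.n + 1) → ZMod S.M =>
            (S.inst b₂ v₂).phi7 z ≠ 0 ∧ (S.inst b₃ v₃).phi7 z ≠ 0).card : ℝ)) ^ 2 := by ring


/-! ### The three moves at DIVISOR level: normalised overlap at least `g/Q = 1/q` for `g·q = Q` -/

/-- `p₁·g·q = P` when `g·q = Q`. [cite: ChenQuantumLattice2024, Cond. C.3 p. 18] -/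
theorem p₁g_mul_q {g q : ℕ} (hgq : g * q = (S.Q : ℕ)) : S.p₁ * g * q = (S.P : ℕ) := by
  rw [P_nat, mul_assoc, hgq]

/-- `P = p₁·g·q` as an integer when `g·q = Q`. [cite: ChenQuantumLattice2024, Cond. C.3 p. 18] -/
theorem P_coe_of_dvd {g q : ℕ} (hgq : g * q = (S.Q : ℕ)) :
    ((S.P : ℕ) : ℤ) = (S.p₁ : ℤ) * g * q := by
  have h := p₁g_mul_q hgq
  rw [← h]
  push_cast
  ring

/-- `q` is odd and non-zero when `g·q = Q` (`Q` odd). [cite: ChenQuantumLattice2024, Cond. C.3 p. 18] -/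
theorem odd_of_mul_eq_Q (h : S.Admissible) {g q : ℕ} (hgq : g * q = (S.Q : ℕ)) : Odd q := by
  have hQ := h.odd_Q
  rw [← hgq] at hQ
  exact Nat.Odd.of_mul_right hQ

/-- **Move A at divisor level.**  Two admissible instances with the same offset `v` whose `b`'s agree
modulo `2p₁g` on the coordinates `≥ 1` (`g·q = Q`) satisfy `⟨ψ₂|ψ₂⟩⟨ψ₃|ψ₃⟩ ≤ q²·|⟨ψ₂|ψ₃⟩|²`: rigid with
`ζ = 1`, and the `p₁g` branches `j = q·r` are common for every tail `k` (`2D²·qr·2p₁g = 2M·r`).  With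
`g = 1` (any two `b`'s of the class): overlap `≥ 1/Q`. [cite: ChenQuantumLattice2024, eq. (35) p. 31, eq. (12) p. 17] -/
theorem overlap_same_offset_dvd (h : S.Admissible) {b₂ b₃ v : Fin (S.n + 1) → ℤ}
    (h₂ : (S.inst b₂ v).Admissible) (h₃ : (S.inst b₃ v).Admissible) {g q : ℕ}
    (hgq : g * q = (S.Q : ℕ)) (hbg : ∀ i, i ≠ 0 → (2 * (S.p₁ : ℤ) * g) ∣ b₂ i - b₃ i) :
    (star (S.inst b₂ v).phi7d ⬝ᵥ (S.inst b₂ v).phi7d).re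
        * (star (S.inst b₃ v).phi7d ⬝ᵥ (S.inst b₃ v).phi7d).re
      ≤ (q : ℝ) ^ 2 * ‖star (S.inst b₂ v).phi7d ⬝ᵥ (S.inst b₃ v).phi7d‖ ^ 2 := by
  have hb₂0 : b₂ 0 = -1 := h₂.b_head
  have hb₃0 : b₃ 0 = -1 := h₃.b_head
  have hP := P_coe_of_dvd hgq
  refine overlap_of_rigid_family h₂ h₃ (ζ := 1) norm_one ?_ (p₁g_mul_q hgq) 0 0 ?_
  · intro j k j' k' hj hj' hco
    have hk : k = k' := coincidence_k (S.odd_P h) hco fun t => ⟨0, by ring⟩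
    have hd := coincidence_head hco hb₂0 hb₃0 0 (by ring)
    rw [sub_zero] at hd
    have hjj : j = j' := nat_eq_of_dvd_sub_of_lt hj hj' hd
    subst hk hjj
    exact S.conj_amp7_mul_self j k
  · intro r hr k
    funext i
    refine (pt7_inst_apply_eq_iff _ _ _ _ _ _ k i).2 ?_
    rw [S.M_coe]
    rcases Fin.eq_zero_or_eq_succ i with rfl | ⟨t, rfl⟩
    · refine ⟨0, ?_⟩
      rw [hb₂0, hb₃0]
      push_cast
      ring
    · obtain ⟨c, hc⟩ := hbg t.succ (Fin.succ_ne_zero t)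
      refine ⟨-(2 * (r : ℤ) * c), ?_⟩
      push_cast
      linear_combination (-2 * (S.D : ℤ) * S.D * q * r) * hc + (4 * (S.D : ℤ) * S.D * r * c) * hP

/-- **Move T at divisor level.**  For `m ∈ gℤ^{n+1}` with `m₀ = 0` (`g·q = Q`), the instances `(b, v)` and
`(b − 2p₁m, v + 4D²p₁m)` satisfy `⟨ψ₂|ψ₂⟩⟨ψ₃|ψ₃⟩ ≤ q²·|⟨ψ₂|ψ₃⟩|²`: rigid with `ζ = 1`, the `p₁g` branches
`j = 1 + q·r` common. [cite: ChenQuantumLattice2024, eq. (35) p. 31, eq. (12) p. 17] -/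
theorem overlap_moveT_dvd (h : S.Admissible) {b v : Fin (S.n + 1) → ℤ} (hI : (S.inst b v).Admissible)
    {g q : ℕ} (hgq : g * q = (S.Q : ℕ)) (m : Fin (S.n + 1) → ℤ) (hm : m 0 = 0)
    (hmg : ∀ i, (g : ℤ) ∣ m i) :
    (star (S.inst b v).phi7d ⬝ᵥ (S.inst b v).phi7d).re
        * (star (S.inst (fun i => b i - 2 * (S.p₁ : ℤ) * m i)
              (fun i => v i + 4 * (S.D : ℤ) * S.D * S.p₁ * m i)).phi7d
            ⬝ᵥ (S.inst (fun i => b i - 2 * (S.p₁ : ℤ) * m i)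
              (fun i => v i + 4 * (S.D : ℤ) * S.D * S.p₁ * m i)).phi7d).re
      ≤ (q : ℝ) ^ 2 * ‖star (S.inst b v).phi7d ⬝ᵥ
          (S.inst (fun i => b i - 2 * (S.p₁ : ℤ) * m i)
            (fun i => v i + 4 * (S.D : ℤ) * S.D * S.p₁ * m i)).phi7d‖ ^ 2 := by
  have hb0 : b 0 = -1 := hI.b_head
  have hP := P_coe_of_dvd hgq
  have h₃ : (S.inst (fun i => b i - 2 * (S.p₁ : ℤ) * m i)
      (fun i => v i + 4 * (S.D : ℤ) * S.D * S.p₁ * m i)).Admissible := by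
    refine S.inst_admissible h ?_ (fun i hi => ?_) (fun i => ?_)
    · show b 0 - 2 * (S.p₁ : ℤ) * m 0 = -1
      rw [hm, hb0]
      ring
    · exact dvd_sub (hI.b_tail i hi) ⟨m i, by ring⟩
    · exact dvd_add (hI.v'_in_DZ i) ⟨4 * S.D * S.p₁ * m i, by ring⟩
  refine overlap_of_rigid_family hI h₃ (ζ := 1) norm_one ?_ (p₁g_mul_q hgq) 1 1 ?_
  · intro j k j' k' hj hj' hco
    have hk : k = k' :=
      coincidence_k (S.odd_P h) hco fun t => ⟨2 * S.p₁ * m t.succ, by ring⟩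
    have hd := coincidence_head hco hb0 (by show b 0 - 2 * (S.p₁ : ℤ) * m 0 = -1; rw [hm, hb0]; ring) 0
      (by show v 0 + 4 * (S.D : ℤ) * S.D * S.p₁ * m 0 - v 0 = _; rw [hm]; ring)
    rw [sub_zero] at hd
    have hjj : j = j' := nat_eq_of_dvd_sub_of_lt hj hj' hd
    subst hk hjj
    exact S.conj_amp7_mul_self j k
  · intro r hr k
    funext i
    refine (pt7_inst_apply_eq_iff _ _ _ _ _ _ k i).2 ?_
    rw [S.M_coe]
    obtain ⟨μ, hμ⟩ := hmg i
    refine ⟨-(2 * μ * r), ?_⟩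
    push_cast
    linear_combination (4 * (S.D : ℤ) * S.D * μ * r) * hP
      + (-4 * (S.D : ℤ) * S.D * S.p₁ * q * r) * hμ

/-- The amplitude product of Move C at divisor level: if `j = j′ + p₁ga − Pc` and `q ∣ j′` (`g·q = Q`) then
`conj(amp7 j k)·amp7 j′ k = e(p₁ga²/q)`. [cite: ChenQuantumLattice2024, eq. (35) p. 31, Cond. C.3 p. 18] -/
theorem conj_amp7_mul_amp7_moveC_dvd {j j' : ℕ} (k : Fin S.n → Fin 2) {g q : ℕ}
    (hgq : g * q = (S.Q : ℕ)) (a c s' : ℤ)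
    (hj : (j : ℤ) = j' + S.p₁ * g * a - S.P * c) (hj' : (j' : ℤ) = q * s') :
    (starRingEnd ℂ) (S.amp7 j k) * S.amp7 j' k = e ((S.p₁ : ℚ) * g * a ^ 2 / q) := by
  have hq0 : q ≠ 0 := by
    rintro rfl
    rw [mul_zero] at hgq
    exact S.Q.ne_zero hgq.symm
  have hg0 : g ≠ 0 := by
    rintro rfl
    rw [zero_mul] at hgq
    exact S.Q.ne_zero hgq.symm
  rw [conj_amp7_mul_amp7]
  apply e_eq_e_of_sub_eq_intCast (2 * s' * a - 2 * q * s' * c - 2 * S.p₁ * g * a * c + S.P * c ^ 2)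
  have hjQ : (j : ℚ) = j' + S.p₁ * g * a - S.P * c := by exact_mod_cast hj
  have hj'Q : (j' : ℚ) = q * s' := by exact_mod_cast hj'
  have hPq : ((S.P : ℕ) : ℚ) = (S.p₁ : ℚ) * g * q := by exact_mod_cast P_coe_of_dvd hgq
  rw [hjQ, hj'Q]
  push_cast
  rw [hPq]
  have hq : (q : ℚ) ≠ 0 := by exact_mod_cast hq0
  have hg : (g : ℚ) ≠ 0 := by exact_mod_cast hg0
  have hp : ((S.p₁ : ℕ) : ℚ) ≠ 0 := by exact_mod_cast S.p₁.ne_zero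
  field_simp
  ring

/-- **Move C at divisor level.**  For a coordinate `t₁+1`, `a ∈ ℤ` and `g·q = Q`, the instances `(b, v)` and
`(b − 2p₁g·e_{t₁+1}, v + 2D²p₁g·a·b)` — the offset moves by `−2D²p₁g·a` on coordinate `0` — satisfy
`⟨ψ₂|ψ₂⟩⟨ψ₃|ψ₃⟩ ≤ q²·|⟨ψ₂|ψ₃⟩|²`: at a coincidence coordinate `0` forces `j ≡ j′ + p₁ga`, coordinate `t₁+1`
forces `q ∣ j′`, so the amplitude product is always `e(p₁ga²/q)`; the `p₁g` pairs `(p₁ga + q·r, q·r)`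
coincide. (`g = 1` is Move C of gen 6 with the sharper count.)
[cite: ChenQuantumLattice2024, eq. (35) p. 31, eq. (12) p. 17, Cond. C.3 p. 18] -/
theorem overlap_moveC_dvd (h : S.Admissible) {b v : Fin (S.n + 1) → ℤ} (hI : (S.inst b v).Admissible)
    {g q : ℕ} (hgq : g * q = (S.Q : ℕ)) (t₁ : Fin S.n) (a : ℤ) :
    (star (S.inst b v).phi7d ⬝ᵥ (S.inst b v).phi7d).re
        * (star (S.inst (Function.update b t₁.succ (b t₁.succ - 2 * (S.p₁ : ℤ) * g))
              (fun i => v i + 2 * (S.D : ℤ) * S.D * S.p₁ * g * a * b i)).phi7d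
            ⬝ᵥ (S.inst (Function.update b t₁.succ (b t₁.succ - 2 * (S.p₁ : ℤ) * g))
              (fun i => v i + 2 * (S.D : ℤ) * S.D * S.p₁ * g * a * b i)).phi7d).re
      ≤ (q : ℝ) ^ 2 * ‖star (S.inst b v).phi7d ⬝ᵥ
          (S.inst (Function.update b t₁.succ (b t₁.succ - 2 * (S.p₁ : ℤ) * g))
            (fun i => v i + 2 * (S.D : ℤ) * S.D * S.p₁ * g * a * b i)).phi7d‖ ^ 2 := by
  have hb0 : b 0 = -1 := hI.b_head
  have hb'0 : Function.update b t₁.succ (b t₁.succ - 2 * (S.p₁ : ℤ) * g) 0 = -1 := by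
    rw [Function.update_of_ne (Fin.succ_ne_zero t₁).symm, hb0]
  have hb't : Function.update b t₁.succ (b t₁.succ - 2 * (S.p₁ : ℤ) * g) t₁.succ
      = b t₁.succ - 2 * (S.p₁ : ℤ) * g :=
    Function.update_self _ _ _
  have h₃ : (S.inst (Function.update b t₁.succ (b t₁.succ - 2 * (S.p₁ : ℤ) * g))
      (fun i => v i + 2 * (S.D : ℤ) * S.D * S.p₁ * g * a * b i)).Admissible := by
    refine S.inst_admissible h hb'0 (fun i hi => ?_) (fun i => ?_)
    · by_cases hit : i = t₁.succ
      · subst hit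
        rw [hb't]
        exact dvd_sub (hI.b_tail _ hi) ⟨g, by ring⟩
      · rw [Function.update_of_ne hit]
        exact hI.b_tail i hi
    · exact dvd_add (hI.v'_in_DZ i) ⟨2 * S.D * S.p₁ * g * a * b i, by ring⟩
  have hP0 : (0 : ℤ) < (S.P : ℕ) := by exact_mod_cast S.P.pos
  have hj0 : (0 : ℤ) ≤ ((S.p₁ : ℤ) * g * a) % (S.P : ℕ) := Int.emod_nonneg _ hP0.ne'
  have hP := P_coe_of_dvd hgq
  obtain ⟨r, hr⟩ := odd_of_mul_eq_Q h hgq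
  have hq' : (q : ℤ) = 2 * r + 1 := by exact_mod_cast hr
  have hpg : ((S.p₁ : ℤ) * g) ≠ 0 := by
    have hg0 : g ≠ 0 := by
      rintro rfl
      rw [zero_mul] at hgq
      exact S.Q.ne_zero hgq.symm
    have h1 : (S.p₁ : ℤ) ≠ 0 := by exact_mod_cast S.p₁.ne_zero
    have h2 : (g : ℤ) ≠ 0 := by exact_mod_cast hg0
    exact mul_ne_zero h1 h2
  refine overlap_of_rigid_family hI h₃ (ζ := e ((S.p₁ : ℚ) * g * a ^ 2 / q)) (norm_e _) ?_
    (p₁g_mul_q hgq) ((((S.p₁ : ℤ) * g * a) % (S.P : ℕ)).toNat) 0 ?_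
  · intro j k j' k' hj hj' hco
    have hk : k = k' :=
      coincidence_k (S.odd_P h) hco fun t => ⟨S.p₁ * g * a * b t.succ, by ring⟩
    obtain ⟨c, hc⟩ := coincidence_head hco hb0 hb'0 (-(S.p₁ * g * a))
      (by show v 0 + 2 * (S.D : ℤ) * S.D * S.p₁ * g * a * b 0 - v 0 = _; rw [hb0]; ring)
    obtain ⟨d, hd⟩ := coincidence_tail hco t₁ (congr_fun hk t₁) (S.p₁ * g * a * b t₁.succ) (by ring)
    rw [hb't] at hd
    have hu : 2 * (j' : ℤ) = q * (d + b t₁.succ * c) := by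
      refine mul_left_cancel₀ hpg ?_
      linear_combination hd + (b t₁.succ) * hc + (d + b t₁.succ * c) * hP
    have hj'q : (j' : ℤ) = q * ((r + 1) * (d + b t₁.succ * c) - j') := by
      linear_combination (r + 1 : ℤ) * hu + (j' : ℤ) * hq'
    have hjj : (j : ℤ) = j' + S.p₁ * g * a - S.P * c := by linear_combination (-1 : ℤ) * hc
    subst hk
    exact S.conj_amp7_mul_amp7_moveC_dvd k hgq a c _ hjj hj'q
  · intro r' hr' k
    have hjP : ((((((S.p₁ : ℤ) * g * a) % (S.P : ℕ)).toNat : ℕ)) : ℤ)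
        = S.p₁ * g * a - (S.P : ℕ) * (((S.p₁ : ℤ) * g * a) / (S.P : ℕ)) := by
      rw [Int.toNat_of_nonneg hj0, Int.emod_def]
    funext i
    refine (pt7_inst_apply_eq_iff _ _ _ _ _ _ k i).2 ?_
    rw [S.M_coe]
    by_cases hit : i = t₁.succ
    · subst hit
      rw [hb't]
      refine ⟨-(2 * (r' : ℤ)) + b t₁.succ * (((S.p₁ : ℤ) * g * a) / (S.P : ℕ)), ?_⟩
      push_cast
      linear_combination (-2 * (S.D : ℤ) * S.D * b t₁.succ) * hjP + (4 * (S.D : ℤ) * S.D * r') * hP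
    · rw [Function.update_of_ne hit]
      refine ⟨b i * (((S.p₁ : ℤ) * g * a) / (S.P : ℕ)), ?_⟩
      push_cast
      linear_combination (-2 * (S.D : ℤ) * S.D * b i) * hjP


/-! ## Part III.  Links and chains at divisor level; coprime pairs; the tolerance `4εQ² < 1`

### Links: two states with a large overlap receive the same almost-certain outcome -/

/-- A quantitative-overlap inequality `⟨ψ|ψ⟩⟨φ|φ⟩ ≤ c·|⟨ψ|φ⟩|²` between non-zero states forces `⟨ψ|φ⟩ ≠ 0`.
[folklore] -/
theorem dotProduct_ne_zero_of_overlap_le {X : Type*} [Fintype X] {ψ φ : X → ℂ} (hψ : ψ ≠ 0) (hφ : φ ≠ 0)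
    {c : ℝ} (hov : (star ψ ⬝ᵥ ψ).re * (star φ ⬝ᵥ φ).re ≤ c * ‖star ψ ⬝ᵥ φ‖ ^ 2) :
    star ψ ⬝ᵥ φ ≠ 0 := by
  intro h0
  rw [h0, norm_zero, sq, mul_zero, mul_zero] at hov
  exact absurd hov (not_le.2 (mul_pos (star_dotProduct_self_re_pos hψ) (star_dotProduct_self_re_pos hφ)))

/-- If `4εq² < 1` for some `q ≥ 1` then `ε < 1/2`. [folklore] -/
theorem eps_lt_half_of_sq {ε x : ℝ} (hx : 1 ≤ x) (hε : 4 * ε * x ^ 2 < 1) : ε < 1 / 2 := by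
  by_contra hcon
  rw [not_lt] at hcon
  nlinarith [mul_nonneg (sub_nonneg.2 hcon) (sub_nonneg.2 (one_le_pow₀ (n := 2) hx))]

/-- **One link at divisor level (Move A).**  For any POVM and `4εq² < 1` (`g·q = Q`): two admissible
instances with the same offset whose `b`'s agree modulo `2p₁g` on the coordinates `≥ 1` receive the same
`ε`-almost-certain outcome. [cite: ChenQuantumLattice2024, eq. (35) p. 31, Lemma 3.13 pp. 32–34][cite: NielsenChuang2010, §2.2.6 p. 90] -/
theorem sameOutcome_same_offset_dvd (h : S.Admissible) {κ : Type*} [Fintype κ] [DecidableEq κ]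
    (E : POVM (Fin (S.n + 1) → ZMod S.M) κ) {ε : ℝ} {g q : ℕ} (hgq : g * q = (S.Q : ℕ))
    (hε : 4 * ε * (q : ℝ) ^ 2 < 1) {b₂ b₃ v : Fin (S.n + 1) → ℤ}
    (h₂ : (S.inst b₂ v).Admissible) (h₃ : (S.inst b₃ v).Admissible)
    (hbg : ∀ i, i ≠ 0 → (2 * (S.p₁ : ℤ) * g) ∣ b₂ i - b₃ i)
    {k₂ k₃ : κ} (hk₂ : E.AlmostCertain ε (S.inst b₂ v).phi7d k₂)
    (hk₃ : E.AlmostCertain ε (S.inst b₃ v).phi7d k₃) : k₂ = k₃ :=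
  E.eq_of_almostCertain_of_overlap_le hk₂ hk₃ hε (S.overlap_same_offset_dvd h h₂ h₃ hgq hbg)
    (S.dot_phi7d_ne_zero_same_offset h h₂ h₃)

variable (S)

/-- **The chain at divisor level.**  Public data fixed, `U ∋ t₁+1` the unknown coordinates, `E` any POVM
`ε`-almost sure on the class, `g·q = Q` and `4·ε·q² < 1`.  Then the almost-certain outcome is the same on
`(b₂, v₂)` and `(b₂, v₃)` whenever `v₃ ≡ v₂ + 2D²p₁g·(a·b₂ + m) (mod M)` (`a ∈ ℤ`, `m` supported on `U ∖ {0}`):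
the chain `C_g · A_g · T_g · A_g` of divisor-level moves, each of normalised overlap `≥ 1/q`.
[cite: ChenQuantumLattice2024, Lemma 3.13 pp. 32–34, eq. (12) p. 17, eq. (35) p. 31][cite: NielsenChuang2010, §2.2.6 p. 90] -/
theorem step8_povm_ceiling_dvd (h : S.Admissible) {κ : Type*} [Fintype κ] [DecidableEq κ]
    (U : Finset (Fin (S.n + 1))) (t₁ : Fin S.n) (ht₁ : t₁.succ ∈ U)
    (E : POVM (Fin (S.n + 1) → ZMod S.M) κ) {ε : ℝ} {g q : ℕ} (hgq : g * q = (S.Q : ℕ))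
    (hε : 4 * ε * (q : ℝ) ^ 2 < 1) (hE : S.AlmostSureOn ε U E)
    {b₂ v₂ v₃ : Fin (S.n + 1) → ℤ} (hI₂ : S.InClass U b₂ v₂)
    (a : ℤ) (m : Fin (S.n + 1) → ℤ) (hm0 : m 0 = 0) (hmU : ∀ i, i ∉ U → m i = 0)
    (hv : ∀ i, ((v₃ i : ℤ) : ZMod S.M)
      = ((v₂ i + 2 * (S.D : ℤ) * S.D * S.p₁ * g * (a * b₂ i + m i) : ℤ) : ZMod S.M))
    {k₂ k₃ : κ} (hk₂ : E.AlmostCertain ε (S.inst b₂ v₂).phi7d k₂)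
    (hk₃ : E.AlmostCertain ε (S.inst b₂ v₃).phi7d k₃) :
    k₂ = k₃ := by
  obtain ⟨hb₂U, h₂⟩ := hI₂
  have hb₂0 : b₂ 0 = -1 := h₂.b_head
  have hP := P_coe_of_dvd hgq
  obtain ⟨r, hr⟩ := odd_of_mul_eq_Q h hgq
  have hq' : (q : ℤ) = 2 * r + 1 := by exact_mod_cast hr
  have hq1 : (1 : ℝ) ≤ q := by
    have : 1 ≤ q := by omega
    exact_mod_cast this
  -- the chain
  let bC : Fin (S.n + 1) → ℤ := Function.update b₂ t₁.succ (b₂ t₁.succ - 2 * (S.p₁ : ℤ) * g)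
  let vC : Fin (S.n + 1) → ℤ := fun i => v₂ i + 2 * (S.D : ℤ) * S.D * S.p₁ * g * a * b₂ i
  let m' : Fin (S.n + 1) → ℤ := fun i => (g : ℤ) * (((r : ℤ) + 1) * m i)
  let bT : Fin (S.n + 1) → ℤ := fun i => b₂ i - 2 * (S.p₁ : ℤ) * m' i
  let vT : Fin (S.n + 1) → ℤ := fun i => vC i + 4 * (S.D : ℤ) * S.D * S.p₁ * m' i
  have hm'0 : m' 0 = 0 := by
    show (g : ℤ) * (((r : ℤ) + 1) * m 0) = 0
    rw [hm0, mul_zero, mul_zero]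
  have hm'g : ∀ i, (g : ℤ) ∣ m' i := fun i => ⟨((r : ℤ) + 1) * m i, rfl⟩
  have hvC : ∀ i, (S.D : ℤ) ∣ vC i := fun i =>
    dvd_add (h₂.v'_in_DZ i) ⟨2 * S.D * S.p₁ * g * a * b₂ i, by ring⟩
  have hvT : ∀ i, (S.D : ℤ) ∣ vT i := fun i =>
    dvd_add (hvC i) ⟨4 * S.D * S.p₁ * m' i, by ring⟩
  -- admissibility and class membership of the intermediate instances
  have aC : (S.inst bC vC).Admissible := by
    refine S.inst_admissible h ?_ (fun i hi => ?_) hvC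
    · show Function.update b₂ t₁.succ (b₂ t₁.succ - 2 * (S.p₁ : ℤ) * g) 0 = -1
      rw [Function.update_of_ne (Fin.succ_ne_zero t₁).symm, hb₂0]
    · show (2 * (S.p₁ : ℤ)) ∣ Function.update b₂ t₁.succ (b₂ t₁.succ - 2 * (S.p₁ : ℤ) * g) i
      by_cases hit : i = t₁.succ
      · subst hit
        rw [Function.update_self]
        exact dvd_sub (h₂.b_tail _ hi) ⟨g, by ring⟩
      · rw [Function.update_of_ne hit]
        exact h₂.b_tail i hi
  have cC : S.InClass U bC vC := by
    refine ⟨fun i hi => ?_, aC⟩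
    have hit : i ≠ t₁.succ := fun e => hi (e ▸ ht₁)
    show Function.update b₂ t₁.succ (b₂ t₁.succ - 2 * (S.p₁ : ℤ) * g) i = S.b i
    rw [Function.update_of_ne hit, hb₂U i hi]
  have a₂C : (S.inst b₂ vC).Admissible := S.inst_admissible h hb₂0 h₂.b_tail hvC
  have c₂C : S.InClass U b₂ vC := ⟨hb₂U, a₂C⟩
  have aT : (S.inst bT vT).Admissible := by
    refine S.inst_admissible h ?_ (fun i hi => ?_) hvT
    · show b₂ 0 - 2 * (S.p₁ : ℤ) * m' 0 = -1
      rw [hm'0, hb₂0]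
      ring
    · exact dvd_sub (h₂.b_tail i hi) ⟨m' i, by ring⟩
  have cT : S.InClass U bT vT := by
    refine ⟨fun i hi => ?_, aT⟩
    show b₂ i - 2 * (S.p₁ : ℤ) * ((g : ℤ) * (((r : ℤ) + 1) * m i)) = S.b i
    rw [hmU i hi, hb₂U i hi]
    ring
  have a₂T : (S.inst b₂ vT).Admissible := S.inst_admissible h hb₂0 h₂.b_tail hvT
  have c₂T : S.InClass U b₂ vT := ⟨hb₂U, a₂T⟩
  -- the almost-sure outcomes along the chain
  obtain ⟨o₁, ho₁⟩ := hE bC vC cC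
  obtain ⟨o₂, ho₂⟩ := hE b₂ vC c₂C
  obtain ⟨o₃, ho₃⟩ := hE bT vT cT
  obtain ⟨o₄, ho₄⟩ := hE b₂ vT c₂T
  -- the links
  have hCA : ∀ i, i ≠ 0 → (2 * (S.p₁ : ℤ) * g) ∣ bC i - b₂ i := by
    intro i hi
    by_cases hit : i = t₁.succ
    · subst hit
      refine ⟨-1, ?_⟩
      show Function.update b₂ t₁.succ (b₂ t₁.succ - 2 * (S.p₁ : ℤ) * g) t₁.succ - b₂ t₁.succ = _
      rw [Function.update_self]
      ring
    · refine ⟨0, ?_⟩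
      show Function.update b₂ t₁.succ (b₂ t₁.succ - 2 * (S.p₁ : ℤ) * g) i - b₂ i = _
      rw [Function.update_of_ne hit]
      ring
  have hTA : ∀ i, i ≠ 0 → (2 * (S.p₁ : ℤ) * g) ∣ bT i - b₂ i := by
    intro i hi
    refine ⟨-(((r : ℤ) + 1) * m i), ?_⟩
    show b₂ i - 2 * (S.p₁ : ℤ) * ((g : ℤ) * (((r : ℤ) + 1) * m i)) - b₂ i = _
    ring
  have l₁ : k₂ = o₁ :=
    E.eq_of_almostCertain_of_overlap_le hk₂ ho₁ hε (S.overlap_moveC_dvd h h₂ hgq t₁ a)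
      (dotProduct_ne_zero_of_overlap_le ((S.inst b₂ v₂).phi7d_ne_zero h₂)
        ((S.inst bC vC).phi7d_ne_zero aC) (S.overlap_moveC_dvd h h₂ hgq t₁ a))
  have l₂ : o₁ = o₂ := sameOutcome_same_offset_dvd h E hgq hε aC a₂C hCA ho₁ ho₂
  have l₃ : o₂ = o₃ :=
    E.eq_of_almostCertain_of_overlap_le ho₂ ho₃ hε (S.overlap_moveT_dvd h a₂C hgq m' hm'0 hm'g)
      (S.dot_phi7d_ne_zero_moveT h a₂C m' hm'0)
  have l₄ : o₃ = o₄ := sameOutcome_same_offset_dvd h E hgq hε aT a₂T hTA ho₃ ho₄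
  -- the last instance has the same state as `(b₂, v₃)`
  have hcong : ∀ i, ((vT i : ℤ) : ZMod S.M) = ((v₃ i : ℤ) : ZMod S.M) := by
    intro i
    rw [hv i, ZMod.intCast_eq_intCast_iff_dvd_sub, S.M_coe]
    refine ⟨-(m i), ?_⟩
    show v₂ i + 2 * (S.D : ℤ) * S.D * S.p₁ * g * (a * b₂ i + m i)
        - (v₂ i + 2 * (S.D : ℤ) * S.D * S.p₁ * g * a * b₂ i
            + 4 * (S.D : ℤ) * S.D * S.p₁ * ((g : ℤ) * (((r : ℤ) + 1) * m i)))
        = 2 * (S.D : ℤ) * S.D * S.P * -m i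
    linear_combination (2 * (S.D : ℤ) * S.D * m i) * hP + (2 * (S.D : ℤ) * S.D * S.p₁ * g * m i) * hq'
  have hstate : (S.inst b₂ vT).phi7d = (S.inst b₂ v₃).phi7d := S.phi7d_inst_congr b₂ v₃ vT hcong
  rw [← hstate] at hk₃
  have l₅ : o₄ = k₃ :=
    E.almostCertain_unique (eps_lt_half_of_sq hq1 hε) ((S.inst b₂ vT).phi7d_ne_zero a₂T) ho₄ hk₃
  rw [l₁, l₂, l₃, l₄, l₅]

/-- **The robust ceiling at COPRIME-PAIR tolerance.**  Public data fixed, `U ∋ t₁+1` unknown, `E` any POVM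
`ε`-almost sure on the class, and `Q = A·B` with `gcd(A,B) = 1`, `4εA² < 1`, `4εB² < 1`.  Then, exactly as
in `step8_povm_ceiling_robust` (which needed `4εP² < 1`), the almost-certain outcome is the same on
`(b₂,v₂)` and `(b₃,v₃)` whenever `v₃ ≡ v₂ + 2D²p₁(a·b₂ + m) (mod M)`, `m` supported on `U ∖ {0}`, ANY `b₃`
of the class: Bezout `Ax + By = 1` splits the shift into a `B`-divisible one (chain at `q = A`) and an
`A`-divisible one (chain at `q = B`), and the change `b₂ → b₃` into two divisor-level A-moves.
[cite: ChenQuantumLattice2024, Lemma 3.13 pp. 32–34, eq. (12) p. 17, eq. (35) p. 31, Cond. C.3 p. 18][cite: NielsenChuang2010, §2.2.6 p. 90] -/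
theorem step8_povm_ceiling_coprime (h : S.Admissible) {κ : Type*} [Fintype κ] [DecidableEq κ]
    (U : Finset (Fin (S.n + 1))) (t₁ : Fin S.n) (ht₁ : t₁.succ ∈ U)
    (E : POVM (Fin (S.n + 1) → ZMod S.M) κ) {ε : ℝ} {A B : ℕ} (hAB : A * B = (S.Q : ℕ))
    (hcop : Nat.Coprime A B) (hεA : 4 * ε * (A : ℝ) ^ 2 < 1) (hεB : 4 * ε * (B : ℝ) ^ 2 < 1)
    (hE : S.AlmostSureOn ε U E)
    {b₂ v₂ b₃ v₃ : Fin (S.n + 1) → ℤ} (hI₂ : S.InClass U b₂ v₂) (hI₃ : S.InClass U b₃ v₃)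
    (a : ℤ) (m : Fin (S.n + 1) → ℤ) (hm0 : m 0 = 0) (hmU : ∀ i, i ∉ U → m i = 0)
    (hv : ∀ i, ((v₃ i : ℤ) : ZMod S.M)
      = ((v₂ i + 2 * (S.D : ℤ) * S.D * S.p₁ * (a * b₂ i + m i) : ℤ) : ZMod S.M))
    {k₂ k₃ : κ} (hk₂ : E.AlmostCertain ε (S.inst b₂ v₂).phi7d k₂)
    (hk₃ : E.AlmostCertain ε (S.inst b₃ v₃).phi7d k₃) :
    k₂ = k₃ := by
  obtain ⟨hb₂U, h₂⟩ := hI₂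
  obtain ⟨hb₃U, h₃⟩ := hI₃
  have hb₂0 : b₂ 0 = -1 := h₂.b_head
  have hb₃0 : b₃ 0 = -1 := h₃.b_head
  have hBA : B * A = (S.Q : ℕ) := by rw [mul_comm, hAB]
  have hA1 : (1 : ℝ) ≤ A := by
    have hA0 : A ≠ 0 := by
      rintro rfl
      rw [zero_mul] at hAB
      exact S.Q.ne_zero hAB.symm
    have : 1 ≤ A := Nat.one_le_iff_ne_zero.2 hA0
    exact_mod_cast this
  obtain ⟨x, y, hxy⟩ : ∃ x y : ℤ, (A : ℤ) * x + B * y = 1 := by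
    obtain ⟨u, w, huw⟩ := Nat.isCoprime_iff_coprime.2 hcop
    exact ⟨u, w, by linear_combination huw⟩
  -- the intermediate offsets and the intermediate `b`
  let w₁ : Fin (S.n + 1) → ℤ := fun i => v₂ i + 2 * (S.D : ℤ) * S.D * S.p₁ * B * (y * a * b₂ i + y * m i)
  let w₂ : Fin (S.n + 1) → ℤ := fun i => w₁ i + 2 * (S.D : ℤ) * S.D * S.p₁ * A * (x * a * b₂ i + x * m i)
  let b' : Fin (S.n + 1) → ℤ := fun i => b₂ i + (A : ℤ) * x * (b₃ i - b₂ i)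
  have hw₁ : ∀ i, (S.D : ℤ) ∣ w₁ i := fun i =>
    dvd_add (h₂.v'_in_DZ i) ⟨2 * S.D * S.p₁ * B * (y * a * b₂ i + y * m i), by ring⟩
  have hw₂ : ∀ i, (S.D : ℤ) ∣ w₂ i := fun i =>
    dvd_add (hw₁ i) ⟨2 * S.D * S.p₁ * A * (x * a * b₂ i + x * m i), by ring⟩
  have hμ : ∀ i, i ≠ 0 → (2 * (S.p₁ : ℤ)) ∣ b₃ i - b₂ i := fun i hi =>
    dvd_sub (h₃.b_tail i hi) (h₂.b_tail i hi)
  have a₁ : (S.inst b₂ w₁).Admissible := S.inst_admissible h hb₂0 h₂.b_tail hw₁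
  have a₂ : (S.inst b₂ w₂).Admissible := S.inst_admissible h hb₂0 h₂.b_tail hw₂
  have a' : (S.inst b' w₂).Admissible := by
    refine S.inst_admissible h ?_ (fun i hi => ?_) hw₂
    · show b₂ 0 + (A : ℤ) * x * (b₃ 0 - b₂ 0) = -1
      rw [hb₂0, hb₃0]
      ring
    · exact dvd_add (h₂.b_tail i hi) (dvd_mul_of_dvd_right (hμ i hi) _)
  have c' : S.InClass U b' w₂ := by
    refine ⟨fun i hi => ?_, a'⟩
    show b₂ i + (A : ℤ) * x * (b₃ i - b₂ i) = S.b i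
    rw [hb₂U i hi, hb₃U i hi]
    ring
  have a₃ : (S.inst b₃ w₂).Admissible := S.inst_admissible h hb₃0 h₃.b_tail hw₂
  -- the outcomes
  obtain ⟨o₁, ho₁⟩ := hE b₂ w₁ ⟨hb₂U, a₁⟩
  obtain ⟨o₂, ho₂⟩ := hE b₂ w₂ ⟨hb₂U, a₂⟩
  obtain ⟨o₃, ho₃⟩ := hE b' w₂ c'
  obtain ⟨o₄, ho₄⟩ := hE b₃ w₂ ⟨hb₃U, a₃⟩
  -- stage 1: shift divisible by `B`, chain at `q = A`
  have l₁ : k₂ = o₁ :=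
    S.step8_povm_ceiling_dvd h U t₁ ht₁ E hBA hεA hE ⟨hb₂U, h₂⟩ (y * a) (fun i => y * m i)
      (by show y * m 0 = 0; rw [hm0, mul_zero]) (fun i hi => by show y * m i = 0; rw [hmU i hi, mul_zero])
      (fun i => rfl) hk₂ ho₁
  -- stage 2: shift divisible by `A`, chain at `q = B`
  have l₂ : o₁ = o₂ :=
    S.step8_povm_ceiling_dvd h U t₁ ht₁ E hAB hεB hE ⟨hb₂U, a₁⟩ (x * a) (fun i => x * m i)
      (by show x * m 0 = 0; rw [hm0, mul_zero]) (fun i hi => by show x * m i = 0; rw [hmU i hi, mul_zero])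
      (fun i => rfl) ho₁ ho₂
  -- stage 3: `b₂ → b′` (agreeing modulo `2p₁A`), link at `q = B`
  have l₃ : o₂ = o₃ := by
    refine sameOutcome_same_offset_dvd h E hAB hεB a₂ a' (fun i hi => ?_) ho₂ ho₃
    obtain ⟨μ, hμi⟩ := hμ i hi
    refine ⟨-(x * μ), ?_⟩
    show b₂ i - (b₂ i + (A : ℤ) * x * (b₃ i - b₂ i)) = _
    rw [hμi]
    ring
  -- stage 4: `b′ → b₃` (agreeing modulo `2p₁B`, by Bezout), link at `q = A`
  have l₄ : o₃ = o₄ := by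
    refine sameOutcome_same_offset_dvd h E hBA hεA a' a₃ (fun i hi => ?_) ho₃ ho₄
    obtain ⟨μ, hμi⟩ := hμ i hi
    refine ⟨-(y * μ), ?_⟩
    show b₂ i + (A : ℤ) * x * (b₃ i - b₂ i) - b₃ i = _
    linear_combination ((A : ℤ) * x - 1) * hμi + (2 * (S.p₁ : ℤ) * μ) * hxy
  -- the last instance has the same state as `(b₃, v₃)`
  have hcong : ∀ i, ((w₂ i : ℤ) : ZMod S.M) = ((v₃ i : ℤ) : ZMod S.M) := by
    intro i
    rw [hv i]
    congr 1
    show v₂ i + 2 * (S.D : ℤ) * S.D * S.p₁ * B * (y * a * b₂ i + y * m i)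
        + 2 * (S.D : ℤ) * S.D * S.p₁ * A * (x * a * b₂ i + x * m i) = _
    linear_combination (2 * (S.D : ℤ) * S.D * S.p₁ * (a * b₂ i + m i)) * hxy
  have hstate : (S.inst b₃ w₂).phi7d = (S.inst b₃ v₃).phi7d := S.phi7d_inst_congr b₃ v₃ w₂ hcong
  rw [← hstate] at hk₃
  have l₅ : o₄ = k₃ :=
    E.almostCertain_unique (eps_lt_half_of_sq hA1 hεA) ((S.inst b₃ w₂).phi7d_ne_zero a₃) ho₄ hk₃
  rw [l₁, l₂, l₃, l₄, l₅]

/-- **The robust ceiling at tolerance `4·ε·Q² < 1`** — the statement of `step8_povm_ceiling_robust` with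
`P² = p₁²Q²` replaced by `Q²` (the coprime pair `(Q, 1)`).  [cite: ChenQuantumLattice2024, Lemma 3.13 pp. 32–34, eq. (12) p. 17, eq. (35) p. 31][cite: NielsenChuang2010, §2.2.6 p. 90] -/
theorem step8_povm_ceiling_sharp (h : S.Admissible) {κ : Type*} [Fintype κ] [DecidableEq κ]
    (U : Finset (Fin (S.n + 1))) (t₁ : Fin S.n) (ht₁ : t₁.succ ∈ U)
    (E : POVM (Fin (S.n + 1) → ZMod S.M) κ) {ε : ℝ} (hε : 4 * ε * ((S.Q : ℕ) : ℝ) ^ 2 < 1)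
    (hE : S.AlmostSureOn ε U E)
    {b₂ v₂ b₃ v₃ : Fin (S.n + 1) → ℤ} (hI₂ : S.InClass U b₂ v₂) (hI₃ : S.InClass U b₃ v₃)
    (a : ℤ) (m : Fin (S.n + 1) → ℤ) (hm0 : m 0 = 0) (hmU : ∀ i, i ∉ U → m i = 0)
    (hv : ∀ i, ((v₃ i : ℤ) : ZMod S.M)
      = ((v₂ i + 2 * (S.D : ℤ) * S.D * S.p₁ * (a * b₂ i + m i) : ℤ) : ZMod S.M))
    {k₂ k₃ : κ} (hk₂ : E.AlmostCertain ε (S.inst b₂ v₂).phi7d k₂)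
    (hk₃ : E.AlmostCertain ε (S.inst b₃ v₃).phi7d k₃) :
    k₂ = k₃ := by
  have hQ1 : (1 : ℝ) ≤ (S.Q : ℕ) := by exact_mod_cast Nat.one_le_iff_ne_zero.2 S.Q.ne_zero
  have hε1 : 4 * ε * ((1 : ℕ) : ℝ) ^ 2 < 1 := by
    rcases le_or_gt 0 ε with h0 | h0
    · have : 4 * ε * (1 : ℝ) ^ 2 ≤ 4 * ε * ((S.Q : ℕ) : ℝ) ^ 2 := by
        have h4 : (0 : ℝ) ≤ 4 * ε := by linarith
        exact mul_le_mul_of_nonneg_left (by nlinarith) h4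
      push_cast
      linarith
    · push_cast
      linarith
  exact S.step8_povm_ceiling_coprime h U t₁ ht₁ E (A := (S.Q : ℕ)) (B := 1) (mul_one _)
    (Nat.coprime_one_right _) hε hε1 hE hI₂ hI₃ a m hm0 hmU hv hk₂ hk₃

/-- **Corollary (tolerance `4εQ² < 1`): no measurement of the Step-8 register supplies what Step 9 consumes,
even approximately.**  For any unknown coordinates `U ∋ t₁+1` and any POVM `ε`-almost sure on the class:
the admissible instance `(b, v′ + 2D²p₁b)` — SAME `b`, same `step8Output`, DIFFERENT `step9Needs` — receives
the same almost-certain outcome as `S`. [cite: ChenQuantumLattice2024, Lemma 3.13 p. 32, §3.5.9 p. 37] -/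
theorem step8_cannot_supply_step9Needs_povm_sharp (h : S.Admissible) {κ : Type*} [Fintype κ]
    [DecidableEq κ] (U : Finset (Fin (S.n + 1))) (t₁ : Fin S.n) (ht₁ : t₁.succ ∈ U)
    (E : POVM (Fin (S.n + 1) → ZMod S.M) κ) {ε : ℝ} (hε : 4 * ε * ((S.Q : ℕ) : ℝ) ^ 2 < 1)
    (hE : S.AlmostSureOn ε U E) :
    ∃ v₃ : Fin (S.n + 1) → ℤ, (S.inst S.b v₃).Admissible
      ∧ (S.inst S.b v₃).step8Output = S.step8Output
      ∧ (S.inst S.b v₃).step9Needs ≠ S.step9Needs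
      ∧ ∀ k k' : κ, E.AlmostCertain ε S.phi7d k → E.AlmostCertain ε (S.inst S.b v₃).phi7d k' → k = k' := by
  have h₃' : (S.inst S.b (fun i => S.v' i + 2 * (S.D : ℤ) * S.D * S.p₁ * S.b i)).Admissible :=
    S.inst_admissible h h.b_head h.b_tail fun i =>
      dvd_add (h.v'_in_DZ i) ⟨2 * S.D * S.p₁ * S.b i, by ring⟩
  refine ⟨fun i => S.v' i + 2 * (S.D : ℤ) * S.D * S.p₁ * S.b i, h₃', ?_, ?_, ?_⟩
  · show (((S.v' 0 + 2 * (S.D : ℤ) * S.D * S.p₁ * S.b 0 : ℤ)) : ZMod ((S.D : ℕ) ^ 2 * S.p₁))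
        = ((S.v' 0 : ℤ) : ZMod ((S.D : ℕ) ^ 2 * S.p₁))
    rw [ZMod.intCast_eq_intCast_iff_dvd_sub, h.b_head]
    exact ⟨2, by push_cast; ring⟩
  · show (((S.v' 0 + 2 * (S.D : ℤ) * S.D * S.p₁ * S.b 0 : ℤ)) : ZMod S.N) ≠ ((S.v' 0 : ℤ) : ZMod S.N)
    rw [Ne, ZMod.intCast_eq_intCast_iff_dvd_sub, h.b_head, S.N_coe, S.P_coe]
    rintro ⟨c, hc⟩
    have hD : (0 : ℤ) < S.D := by exact_mod_cast S.D.pos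
    have hp : (0 : ℤ) < S.p₁ := by exact_mod_cast S.p₁.pos
    have hQ3 : (3 : ℤ) ≤ S.Q := by exact_mod_cast h.three_le_Q
    have hc' : (S.D : ℤ) * S.D * S.p₁ * (2 - S.Q * c) = 0 := by linear_combination hc
    have h2 : (2 : ℤ) - S.Q * c = 0 := by
      rcases mul_eq_zero.1 hc' with h1 | h1
      · exfalso
        have : (0 : ℤ) < (S.D : ℤ) * S.D * S.p₁ := by positivity
        exact this.ne' h1
      · exact h1
    have : (S.Q : ℤ) * c = 2 := by linarith
    rcases lt_trichotomy c 0 with hc0 | hc0 | hc0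
    · nlinarith
    · rw [hc0, mul_zero] at this
      norm_num at this
    · nlinarith
  · intro k k' hk hk'
    have hS : S.InClass U S.b S.v' := ⟨fun _ _ => rfl, h⟩
    have hS₃ : S.InClass U S.b (fun i => S.v' i + 2 * (S.D : ℤ) * S.D * S.p₁ * S.b i) :=
      ⟨fun _ _ => rfl, h₃'⟩
    exact S.step8_povm_ceiling_sharp h U t₁ ht₁ E hε hE hS hS₃ 1 (fun _ => 0) rfl (fun _ _ => rfl)
      (fun i => by push_cast; ring) hk hk'

/-- The same for the full class (every coordinate `≥ 1` unknown, `n ≥ 1`), tolerance `4εQ² < 1`.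
[cite: ChenQuantumLattice2024, Lemma 3.13 p. 32, §3.5.9 p. 37] -/
theorem step8_cannot_supply_step9Needs_povm_sharp' (h : S.Admissible) (hn : 0 < S.n) {κ : Type*}
    [Fintype κ] [DecidableEq κ] (E : POVM (Fin (S.n + 1) → ZMod S.M) κ) {ε : ℝ}
    (hε : 4 * ε * ((S.Q : ℕ) : ℝ) ^ 2 < 1) (hE : S.AlmostSureOn ε Finset.univ E) :
    ∃ v₃ : Fin (S.n + 1) → ℤ, (S.inst S.b v₃).Admissible
      ∧ (S.inst S.b v₃).step8Output = S.step8Output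
      ∧ (S.inst S.b v₃).step9Needs ≠ S.step9Needs
      ∧ ∀ k k' : κ, E.AlmostCertain ε S.phi7d k → E.AlmostCertain ε (S.inst S.b v₃).phi7d k' → k = k' :=
  S.step8_cannot_supply_step9Needs_povm_sharp h Finset.univ ⟨0, hn⟩ (Finset.mem_univ _) E hε hE

/-- **Corollary (tolerance `4εQ² < 1`): `step9Needs` cannot be read off `|φ7.d⟩`, even with error.**  No POVM
on the Step-8 register with outcomes in `ℤ_N` returns, on `|φ7.d⟩` of every admissible instance, that
instance's `step9Needs = v′₀ mod N` with weight `≥ (1 − ε)⟨φ7.d|φ7.d⟩`, as soon as `4εQ² < 1` (`n ≥ 1`).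
[cite: ChenQuantumLattice2024, Lemma 3.13 p. 32, §3.5 p. 22, §3.5.9 p. 37] -/
theorem step9Needs_not_almostSurely_measurable_sharp (h : S.Admissible) (hn : 0 < S.n) {ε : ℝ}
    (hε : 4 * ε * ((S.Q : ℕ) : ℝ) ^ 2 < 1) (E : POVM (Fin (S.n + 1) → ZMod S.M) (ZMod S.N)) :
    ¬ ∀ b₂ v₂ : Fin (S.n + 1) → ℤ, (S.inst b₂ v₂).Admissible →
        E.AlmostCertain ε (S.inst b₂ v₂).phi7d (S.inst b₂ v₂).step9Needs := by
  intro H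
  have hE : S.AlmostSureOn ε Finset.univ E := fun b₂ v₂ hI => ⟨_, H b₂ v₂ hI.2⟩
  obtain ⟨v₃, h₃, -, hne, hk⟩ := S.step8_cannot_supply_step9Needs_povm_sharp' h hn E hε hE
  exact hne (hk _ _ (H S.b S.v' h) (H S.b v₃ h₃)).symm


/-! ## Part IV.  Overlaps inside the class: how large can they be?

The converse direction.  Two admissible instances `(b₂,v₂)`, `(b₃,v₃)`; write `b₂ − b₃ = 2p₁μ` on the tail
coordinates.  If `Q ∤ μ_t` for one tail `t`, then all branches `j` of `|φ7(b₂,v₂)⟩` whose point carries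
`|φ7(b₃,v₃)⟩` lie in ONE residue class modulo `L = Q / gcd(Q, |μ_t|) ≥ minFac Q`, so the two states have at
most `(P/L)·2ⁿ` common points and `‖⟨φ7(b₂,v₂)|φ7(b₃,v₃)⟩‖ ≤ P·2ⁿ / minFac Q` — normalised overlap at most
`1 / minFac Q`. -/

/-! ### A bound on overlaps by the number of common points -/

/-- The amplitudes of `|φ7⟩` are bounded by one (unimodular on the support). [cite: ChenQuantumLattice2024, eq. (35) p. 31] -/
theorem norm_phi7_le_one (h : S.Admissible) (z : Fin (S.n + 1) → ZMod S.M) : ‖S.phi7 z‖ ≤ 1 := by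
  by_cases hz : S.phi7 z = 0
  · rw [hz, norm_zero]
    exact zero_le_one
  · obtain ⟨j, hj, k, rfl⟩ := S.exists_branch_of_phi7_ne_zero hz
    rw [S.phi7_apply_pt7 h hj k]
    unfold amp7
    rw [norm_mul, norm_e, norm_e, mul_one]

/-- `‖⟨ψ|φ⟩‖ ≤ #{z : ψ z ≠ 0 ∧ φ z ≠ 0}` for vectors with entries of norm `≤ 1`. [folklore] -/
theorem norm_dotProduct_le_card_common {X : Type*} [Fintype X] [DecidableEq X] {ψ φ : X → ℂ}
    (hψ : ∀ z, ‖ψ z‖ ≤ 1) (hφ : ∀ z, ‖φ z‖ ≤ 1) :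
    ‖star ψ ⬝ᵥ φ‖ ≤ ((Finset.univ.filter fun z => ψ z ≠ 0 ∧ φ z ≠ 0).card : ℝ) := by
  classical
  calc ‖star ψ ⬝ᵥ φ‖ = ‖∑ z, star (ψ z) * φ z‖ := rfl
    _ ≤ ∑ z, ‖star (ψ z) * φ z‖ := norm_sum_le _ _
    _ ≤ ∑ z, (if ψ z ≠ 0 ∧ φ z ≠ 0 then (1 : ℝ) else 0) := by
        refine Finset.sum_le_sum fun z _ => ?_
        split_ifs with hz
        · rw [norm_mul, norm_star]
          exact mul_le_one₀ (hψ z) (norm_nonneg _) (hφ z)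
        · rw [not_and_or, not_not, not_not] at hz
          rcases hz with hz | hz
          · rw [hz, star_zero, zero_mul, norm_zero]
          · rw [hz, mul_zero, norm_zero]
    _ = ((Finset.univ.filter fun z => ψ z ≠ 0 ∧ φ z ≠ 0).card : ℝ) := by
        rw [Finset.sum_boole]

/-! ### Two coincidences constrain the difference of the branches -/

/-- **Two coincidences.**  If branch `(j₁,k₁)` of `|φ7(b₂,v₂)⟩` coincides with a branch of `|φ7(b₃,v₃)⟩` and
so does branch `(j₂,k₂)`, then `Q ∣ (j₁ − j₂)·μ_t` on every tail coordinate, where `b₂ − b₃ = 2p₁μ` there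
(subtract the two head congruences and the two tail congruences of eq. (35)).
[cite: ChenQuantumLattice2024, eq. (35) p. 31, eq. (12) p. 17, Cond. C.3 p. 18] -/
theorem two_coincidences_dvd (h : S.Admissible) {b₂ v₂ b₃ v₃ : Fin (S.n + 1) → ℤ} (hb₂ : b₂ 0 = -1)
    (hb₃ : b₃ 0 = -1) {j₁ j₁' j₂ j₂' : ℕ} {k₁ k₁' k₂ k₂' : Fin S.n → Fin 2}
    (h1 : (S.inst b₂ v₂).pt7 j₁ k₁ = (S.inst b₃ v₃).pt7 j₁' k₁')
    (h2 : (S.inst b₂ v₂).pt7 j₂ k₂ = (S.inst b₃ v₃).pt7 j₂' k₂')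
    (t : Fin S.n) {μ : ℤ} (hμ : b₂ t.succ - b₃ t.succ = 2 * (S.p₁ : ℤ) * μ) :
    ((S.Q : ℕ) : ℤ) ∣ ((j₁ : ℤ) - j₂) * μ := by
  obtain ⟨q₁, hq₁⟩ := coincidence_dvd_zero h1 hb₂ hb₃
  obtain ⟨q₂, hq₂⟩ := coincidence_dvd_zero h2 hb₂ hb₃
  obtain ⟨s₁, hs₁⟩ := coincidence_dvd_succ h1 t
  obtain ⟨s₂, hs₂⟩ := coincidence_dvd_succ h2 t
  have hP := S.P_coe
  obtain ⟨r, hr⟩ := h.odd_Q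
  have hQodd : Odd ((S.Q : ℕ) : ℤ) := ⟨r, by exact_mod_cast hr⟩
  have hDp : (S.D : ℤ) * S.D * S.p₁ ≠ 0 := by
    have hD : (S.D : ℤ) ≠ 0 := by exact_mod_cast S.D.ne_zero
    have hp : (S.p₁ : ℤ) ≠ 0 := by exact_mod_cast S.p₁.ne_zero
    exact mul_ne_zero (mul_ne_zero hD hD) hp
  -- `Q ∣ 4 (j₁ − j₂) μ`
  have h4 : ((S.Q : ℕ) : ℤ) ∣ 2 * (2 * (((j₁ : ℤ) - j₂) * μ)) := by
    refine ⟨(((k₁' t : ℕ) : ℤ) - (k₁ t : ℕ) - (k₂' t : ℕ) + (k₂ t : ℕ)) - 2 * (q₁ - q₂) * b₃ t.succ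
      - 2 * (s₁ - s₂), mul_left_cancel₀ hDp ?_⟩
    linear_combination (-1 : ℤ) * hs₁ + hs₂ - (2 * (S.D : ℤ) * S.D * ((j₁ : ℤ) - j₂)) * hμ
      - b₃ t.succ * hq₁ + b₃ t.succ * hq₂
      + ((S.D : ℤ) * S.D * ((((k₁' t : ℕ) : ℤ) - (k₁ t : ℕ) - (k₂' t : ℕ) + (k₂ t : ℕ))
          - 2 * (q₁ - q₂) * b₃ t.succ - 2 * (s₁ - s₂))) * hP
  -- an odd integer dividing `2x` divides `x` (`Literature.NumberTheory.EllipticCurves.dvd_of_odd_dvd_two_mul`,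
  -- not imported to keep the dependency cone of this bundle inside `Computability/Cryptography`)
  have hodd : ∀ x : ℤ, ((S.Q : ℕ) : ℤ) ∣ 2 * x → ((S.Q : ℕ) : ℤ) ∣ x := fun x hx => by
    obtain ⟨r, hr⟩ := hQodd
    obtain ⟨y, hy⟩ := hx
    exact ⟨(r + 1) * y - x, by linear_combination (r + 1) * hy + x * hr⟩
  exact hodd _ (hodd _ h4)

/-! ### The branches carrying the other state lie in one residue class -/

/-- In `[0,P)`, a residue class modulo a divisor `L` of `P` has at most `P/L` elements. [folklore] -/
theorem card_filter_range_mod_le (P L r : ℕ) (hLP : L ∣ P) :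
    ((Finset.range P).filter (fun j => j % L = r)).card ≤ P / L := by
  calc ((Finset.range P).filter (fun j => j % L = r)).card ≤ (Finset.range (P / L)).card := by
        refine Finset.card_le_card_of_injOn (fun j => j / L) ?_ ?_
        · intro j hj
          rw [Finset.coe_filter, Set.mem_setOf_eq, Finset.mem_range] at hj
          rw [Finset.coe_range, Set.mem_Iio]
          exact Nat.div_lt_div_of_lt_of_dvd hLP hj.1
        · intro j₁ hj₁ j₂ hj₂ heq
          rw [Finset.coe_filter, Set.mem_setOf_eq, Finset.mem_range] at hj₁ hj₂
          have e₁ := Nat.div_add_mod j₁ L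
          have e₂ := Nat.div_add_mod j₂ L
          have heq' : j₁ / L = j₂ / L := heq
          rw [← e₁, ← e₂, heq', hj₁.2, hj₂.2]
    _ = P / L := Finset.card_range _

/-- **The residue-class lemma.**  If `Q ∤ μ_t` (`b₂ − b₃ = 2p₁μ` on tail `t`), the branches `j ∈ [0,P)` of
`|φ7(b₂,v₂)⟩` at whose points (for some `k`) `|φ7(b₃,v₃)⟩` does not vanish number at most `P/L` for some
divisor `L` of `Q` with `minFac Q ≤ L`. [cite: ChenQuantumLattice2024, eq. (35) p. 31, Cond. C.3 p. 18] -/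
theorem card_carrying_branches_le (h : S.Admissible) {b₂ v₂ b₃ v₃ : Fin (S.n + 1) → ℤ}
    (hb₂ : b₂ 0 = -1) (hb₃ : b₃ 0 = -1) (t : Fin S.n) {μ : ℤ}
    (hμ : b₂ t.succ - b₃ t.succ = 2 * (S.p₁ : ℤ) * μ) (hQμ : ¬ ((S.Q : ℕ) : ℤ) ∣ μ)
    (J : Finset ℕ) (hJP : ∀ j ∈ J, j < (S.P : ℕ))
    (hJ : ∀ j ∈ J, ∃ k, (S.inst b₃ v₃).phi7 ((S.inst b₂ v₂).pt7 j k) ≠ 0) :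
    ∃ L : ℕ, L ∣ (S.Q : ℕ) ∧ Nat.minFac (S.Q : ℕ) ≤ L ∧ J.card ≤ (S.P : ℕ) / L := by
  classical
  set g₀ : ℕ := Nat.gcd (S.Q : ℕ) μ.natAbs with hg₀
  have hg₀Q : g₀ ∣ (S.Q : ℕ) := Nat.gcd_dvd_left _ _
  have hg₀μ : g₀ ∣ μ.natAbs := Nat.gcd_dvd_right _ _
  have hg₀pos : 0 < g₀ := Nat.gcd_pos_of_pos_left _ S.Q.pos
  set L : ℕ := (S.Q : ℕ) / g₀
  have hgL : g₀ * L = (S.Q : ℕ) := Nat.mul_div_cancel' hg₀Q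
  have hLQ : L ∣ (S.Q : ℕ) := ⟨g₀, by rw [mul_comm, hgL]⟩
  have hL0 : L ≠ 0 := by
    intro h0
    rw [h0, mul_zero] at hgL
    exact S.Q.ne_zero hgL.symm
  have hL1 : L ≠ 1 := by
    intro h1
    rw [h1, mul_one] at hgL
    apply hQμ
    rw [← hgL]
    exact Int.natCast_dvd.2 hg₀μ
  have hL2 : 2 ≤ L := (Nat.two_le_iff L).2 ⟨hL0, hL1⟩
  refine ⟨L, hLQ, Nat.minFac_le_of_dvd hL2 hLQ, ?_⟩
  -- all elements of `J` are congruent modulo `L`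
  have hcong : ∀ j₁ ∈ J, ∀ j₂ ∈ J, j₁ % L = j₂ % L := by
    intro j₁ hj₁ j₂ hj₂
    obtain ⟨k₁, hk₁⟩ := hJ j₁ hj₁
    obtain ⟨k₂, hk₂⟩ := hJ j₂ hj₂
    obtain ⟨j₁', -, k₁', e₁⟩ := (S.inst b₃ v₃).exists_branch_of_phi7_ne_zero hk₁
    obtain ⟨j₂', -, k₂', e₂⟩ := (S.inst b₃ v₃).exists_branch_of_phi7_ne_zero hk₂
    have hQ := S.two_coincidences_dvd h hb₂ hb₃ e₁ e₂ t hμ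
    -- `Q ∣ (j₁ − j₂) μ` ⇒ `L ∣ j₁ − j₂`
    have hnat : (S.Q : ℕ) ∣ ((j₁ : ℤ) - j₂).natAbs * μ.natAbs := by
      rw [← Int.natAbs_mul]
      exact Int.natCast_dvd.1 hQ
    obtain ⟨μ', hμ'⟩ := hg₀μ
    have hcop : Nat.Coprime L μ' := by
      have hc := Nat.coprime_div_gcd_div_gcd (m := (S.Q : ℕ)) (n := μ.natAbs) hg₀pos
      have e1 : μ.natAbs / g₀ = μ' := by
        rw [hμ', Nat.mul_div_cancel_left _ hg₀pos]
      rwa [← hg₀, e1] at hc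
    have hLd : L ∣ ((j₁ : ℤ) - j₂).natAbs := by
      refine hcop.dvd_of_dvd_mul_right (Nat.dvd_of_mul_dvd_mul_right hg₀pos ?_)
      have e2 : ((j₁ : ℤ) - j₂).natAbs * μ' * g₀ = ((j₁ : ℤ) - j₂).natAbs * μ.natAbs := by
        rw [hμ']
        ring
      rw [e2, mul_comm L, hgL]
      exact hnat
    have hint : (L : ℤ) ∣ (j₁ : ℤ) - j₂ := Int.natCast_dvd.2 hLd
    exact (Nat.modEq_iff_dvd.2 hint : j₂ ≡ j₁ [MOD L]).symm
  by_cases hJe : J = ∅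
  · rw [hJe, Finset.card_empty]
    exact Nat.zero_le _
  · obtain ⟨j₁, hj₁⟩ := Finset.nonempty_iff_ne_empty.2 hJe
    have hsub : J ⊆ (Finset.range (S.P : ℕ)).filter (fun j => j % L = j₁ % L) := by
      intro j hj
      rw [Finset.mem_filter, Finset.mem_range]
      exact ⟨hJP j hj, hcong j hj j₁ hj₁⟩
    have hLP : L ∣ (S.P : ℕ) := hLQ.trans ⟨S.p₁, by rw [P_nat, mul_comm]⟩
    exact (Finset.card_le_card hsub).trans (card_filter_range_mod_le _ _ _ hLP)

/-- **Overlap bound off the `b`-congruence class.**  If `Q ∤ μ_t` for some tail `t` (`b₂ − b₃ = 2p₁μ`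
there), then `‖⟨φ7(b₂,v₂)|φ7(b₃,v₃)⟩‖·minFac Q ≤ P·2ⁿ = ⟨φ7|φ7⟩`: normalised overlap at most `1/minFac Q`.
[cite: ChenQuantumLattice2024, eq. (35) p. 31, Cond. C.3 p. 18] -/
theorem norm_dot_phi7_mul_minFac_le (h : S.Admissible) {b₂ v₂ b₃ v₃ : Fin (S.n + 1) → ℤ}
    (h₂ : (S.inst b₂ v₂).Admissible) (h₃ : (S.inst b₃ v₃).Admissible) (t : Fin S.n) {μ : ℤ}
    (hμ : b₂ t.succ - b₃ t.succ = 2 * (S.p₁ : ℤ) * μ) (hQμ : ¬ ((S.Q : ℕ) : ℤ) ∣ μ) :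
    ‖star (S.inst b₂ v₂).phi7 ⬝ᵥ (S.inst b₃ v₃).phi7‖ * (Nat.minFac (S.Q : ℕ))
      ≤ ((S.P : ℕ) : ℝ) * 2 ^ S.n := by
  classical
  -- the carrying branches
  set J : Finset ℕ := (Finset.range (S.P : ℕ)).filter
    (fun j => ∃ k, (S.inst b₃ v₃).phi7 ((S.inst b₂ v₂).pt7 j k) ≠ 0) with hJ
  obtain ⟨L, hLQ, hmin, hcard⟩ := S.card_carrying_branches_le h h₂.b_head h₃.b_head t hμ hQμ J
    (fun j hj => Finset.mem_range.1 (Finset.mem_filter.1 hj).1) (fun j hj => (Finset.mem_filter.1 hj).2)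
  have hLpos : 0 < L := lt_of_lt_of_le (Nat.minFac_pos _) hmin
  have hLP : L ∣ (S.P : ℕ) := hLQ.trans ⟨S.p₁, by rw [P_nat, mul_comm]⟩
  -- common points ⊆ image of `J × {0,1}ⁿ`
  have hcommon : (Finset.univ.filter fun z => (S.inst b₂ v₂).phi7 z ≠ 0 ∧ (S.inst b₃ v₃).phi7 z ≠ 0)
      ⊆ (J ×ˢ (Finset.univ : Finset (Fin S.n → Fin 2))).image
          (fun jk => (S.inst b₂ v₂).pt7 jk.1 jk.2) := by
    intro z hz
    rw [Finset.mem_filter] at hz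
    obtain ⟨j, hj, k, hzjk⟩ := (S.inst b₂ v₂).exists_branch_of_phi7_ne_zero hz.2.1
    rw [Finset.mem_image]
    refine ⟨(j, k), Finset.mem_product.2 ⟨Finset.mem_filter.2 ⟨Finset.mem_range.2 hj, k, ?_⟩,
      Finset.mem_univ _⟩, hzjk.symm⟩
    rw [← hzjk]
    exact hz.2.2
  have hcount : ((Finset.univ.filter fun z =>
      (S.inst b₂ v₂).phi7 z ≠ 0 ∧ (S.inst b₃ v₃).phi7 z ≠ 0).card : ℝ) ≤ ((S.P : ℕ) / L : ℕ) * 2 ^ S.n := by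
    have h1 := (Finset.card_le_card hcommon).trans Finset.card_image_le
    rw [Finset.card_product, Finset.card_univ, Fintype.card_fun, Fintype.card_fin, Fintype.card_fin] at h1
    have h2 : J.card * 2 ^ S.n ≤ ((S.P : ℕ) / L) * 2 ^ S.n := Nat.mul_le_mul_right _ hcard
    exact_mod_cast h1.trans h2
  have hnorm := norm_dotProduct_le_card_common ((S.inst b₂ v₂).norm_phi7_le_one h₂)
    ((S.inst b₃ v₃).norm_phi7_le_one h₃)
  have hdiv : (((S.P : ℕ) / L : ℕ) : ℝ) * L = (S.P : ℕ) := by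
    exact_mod_cast Nat.div_mul_cancel hLP
  have hmin' : ((Nat.minFac (S.Q : ℕ) : ℕ) : ℝ) ≤ L := by exact_mod_cast hmin
  calc ‖star (S.inst b₂ v₂).phi7 ⬝ᵥ (S.inst b₃ v₃).phi7‖ * (Nat.minFac (S.Q : ℕ))
      ≤ (((S.P : ℕ) / L : ℕ) * 2 ^ S.n) * L :=
        mul_le_mul (hnorm.trans hcount) hmin' (Nat.cast_nonneg _) (by positivity)
    _ = ((S.P : ℕ) : ℝ) * 2 ^ S.n := by rw [mul_right_comm, hdiv]

/-! ### Inside the `b`-congruence class: `|φ7⟩` depends on `b` only modulo `P` -/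

/-- The points of `|φ7⟩` of an instance depend on `b` only modulo `P` (`2D²j·P ≡ 0 mod M`).
[cite: ChenQuantumLattice2024, eq. (35) p. 31] -/
theorem pt7_inst_congr_b {b₂ b₃ : Fin (S.n + 1) → ℤ} (v : Fin (S.n + 1) → ℤ)
    (hb : ∀ i, ((S.P : ℕ) : ℤ) ∣ b₃ i - b₂ i) : (S.inst b₃ v).pt7 = (S.inst b₂ v).pt7 := by
  funext j k i
  obtain ⟨c, hc⟩ := hb i
  have key : ((2 * (S.D : ℤ) * j * ((S.D : ℤ) * b₃ i) + v i + (S.N : ℤ) * S.kLift k i : ℤ) : ZMod S.M)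
      = ((2 * (S.D : ℤ) * j * ((S.D : ℤ) * b₂ i) + v i + (S.N : ℤ) * S.kLift k i : ℤ) : ZMod S.M) := by
    rw [ZMod.intCast_eq_intCast_iff_dvd_sub, S.M_coe]
    exact ⟨-((j : ℤ) * c), by linear_combination (-(2 * (S.D : ℤ) * S.D * j)) * hc⟩
  exact key

/-- Hence `|φ7⟩` depends on `b` only modulo `P`. [cite: ChenQuantumLattice2024, eq. (35) p. 31] -/
theorem phi7_inst_congr_b {b₂ b₃ : Fin (S.n + 1) → ℤ} (v : Fin (S.n + 1) → ℤ)
    (hb : ∀ i, ((S.P : ℕ) : ℤ) ∣ b₃ i - b₂ i) : (S.inst b₃ v).phi7 = (S.inst b₂ v).phi7 := by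
  funext z
  rw [phi7_apply, phi7_apply, S.pt7_inst_congr_b v hb]
  rfl

/-- Hence `|φ7.d⟩` depends on `b` only modulo `P`. [cite: ChenQuantumLattice2024, §3.5.8 pp. 32–33] -/
theorem phi7d_inst_congr_b {b₂ b₃ : Fin (S.n + 1) → ℤ} (v : Fin (S.n + 1) → ℤ)
    (hb : ∀ i, ((S.P : ℕ) : ℤ) ∣ b₃ i - b₂ i) : (S.inst b₃ v).phi7d = (S.inst b₂ v).phi7d := by
  show qft (n := S.n + 1) (m := (S.M : ℕ)) (kick S.kick8 (S.divideByD (domainExt (S.D : ℕ) (S.inst b₃ v).phi7)))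
    = qft (n := S.n + 1) (m := (S.M : ℕ)) (kick S.kick8 (S.divideByD (domainExt (S.D : ℕ) (S.inst b₂ v).phi7)))
  rw [S.phi7_inst_congr_b v hb]

/-! ## Part V.  Same `b`: `|φ7⟩` and its translates by inequivalent offsets are orthogonal

For two instances with the SAME `b` (and, by Part IV's congruence lemma, for `b`'s congruent modulo `P`),
`⟨φ7(b,v′)|φ7(b,v)⟩ = P·2ⁿ·[v ≡ v′ (mod M)]`: expand both states over their branches, re-index the second by
the shift `(x, d) = (j′ − j, k′ − k)`, observe that the coincidence condition depends on `(x,d)` only, and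
evaluate the `j`-sum (a complete chirp sum, `P·[x = 0]`) and the `k`-sum (`∏_t (1 + 1)` or `∏_t (i − i)`,
`2ⁿ·[d = 0]`). -/

/-- `⟨φ7|φ⟩` expanded over the branches of `|φ7⟩`. [cite: ChenQuantumLattice2024, eq. (35) p. 31] -/
theorem star_phi7_dotProduct (φ : (Fin (S.n + 1) → ZMod S.M) → ℂ) :
    star S.phi7 ⬝ᵥ φ = ∑ j ∈ Finset.range (S.P : ℕ), ∑ k : Fin S.n → Fin 2,
      (starRingEnd ℂ) (S.amp7 j k) * φ (S.pt7 j k) := by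
  classical
  simp only [dotProduct, Pi.star_apply, Complex.star_def, phi7_apply, map_sum, Finset.sum_mul]
  rw [Finset.sum_comm]
  refine Finset.sum_congr rfl fun j _ => ?_
  rw [Finset.sum_comm]
  refine Finset.sum_congr rfl fun k _ => ?_
  have h2 : ∀ z, (starRingEnd ℂ) (if z = S.pt7 j k then S.amp7 j k else 0) * φ z
      = if z = S.pt7 j k then (starRingEnd ℂ) (S.amp7 j k) * φ z else 0 := by
    intro z
    split_ifs with hz
    · rfl
    · rw [map_zero, zero_mul]
  simp_rw [h2]
  rw [Finset.sum_ite_eq' Finset.univ (S.pt7 j k), if_pos (Finset.mem_univ _)]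

/-- Re-indexing the branches of the second state by the shift `(x, d) = (j′ − j mod P, k′ − k)`.
[cite: ChenQuantumLattice2024, eq. (35) p. 31] -/
theorem sum_branches_reindex (F : ℕ → (Fin S.n → Fin 2) → ℂ) (j : ℕ) (k : Fin S.n → Fin 2) :
    ∑ j' ∈ Finset.range (S.P : ℕ), ∑ k' : Fin S.n → Fin 2, F j' k'
      = ∑ x : ZMod (S.P : ℕ), ∑ d : Fin S.n → Fin 2, F ((x + (j : ZMod (S.P : ℕ))).val) (k + d) := by
  have h1 : ∑ j' ∈ Finset.range (S.P : ℕ), ∑ k', F j' k'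
      = ∑ j' ∈ Finset.range (S.P : ℕ),
          (fun y : ZMod (S.P : ℕ) => ∑ k', F y.val k') (j' : ZMod (S.P : ℕ)) := by
    refine Finset.sum_congr rfl fun j' hj' => ?_
    simp only [ZMod.val_natCast, Nat.mod_eq_of_lt (Finset.mem_range.1 hj')]
  rw [h1, sum_range_eq_sum_zmod (S.P : ℕ) (fun y : ZMod (S.P : ℕ) => ∑ k', F y.val k')]
  refine (Fintype.sum_equiv (Equiv.addRight (j : ZMod (S.P : ℕ)))
    (fun x => ∑ d : Fin S.n → Fin 2, F ((x + (j : ZMod (S.P : ℕ))).val) (k + d))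
    (fun y : ZMod (S.P : ℕ) => ∑ k', F y.val k') fun x => ?_).symm
  exact Fintype.sum_equiv (Equiv.addLeft k) _ _ fun d => rfl

/-- `(x + j).val ≡ x.val + j`, as integers with an explicit multiple of the modulus. [folklore] -/
theorem val_add_natCast_eq (m : ℕ) [NeZero m] (x : ZMod m) (j : ℕ) :
    ∃ c : ℤ, ((((x + (j : ZMod m)).val : ℕ)) : ℤ) = (x.val : ℤ) + j - m * c := by
  have h1 : (((((x + (j : ZMod m)).val : ℕ)) : ℤ) : ZMod m) = (((x.val + j : ℕ) : ℤ) : ZMod m) := by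
    push_cast
    rw [ZMod.natCast_zmod_val, ZMod.natCast_zmod_val]
  obtain ⟨c, hc⟩ := (ZMod.intCast_eq_intCast_iff_dvd_sub _ _ _).1 h1
  refine ⟨c, ?_⟩
  push_cast at hc
  linear_combination -hc

/-- Addition in `Fin 2`, as integers. [folklore] -/
theorem fin2_val_add (a c : Fin 2) : ∃ w : ℤ, (((a + c : Fin 2) : ℕ) : ℤ) = (a : ℕ) + (c : ℕ) - 2 * w := by
  fin_cases a <;> fin_cases c
  · exact ⟨0, by decide⟩
  · exact ⟨0, by decide⟩
  · exact ⟨0, by decide⟩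
  · exact ⟨1, by decide⟩

/-- The coincidence condition for two instances with the same `b`, in terms of the shift `(x,d)`:
`2D²x·b + (v − v′) + N·d ≡ 0 (mod M)`. [cite: ChenQuantumLattice2024, eq. (35) p. 31] -/
def SameBCond (v : Fin (S.n + 1) → ℤ) (x : ZMod (S.P : ℕ)) (d : Fin S.n → Fin 2) : Prop :=
  ∀ i, ((2 * (S.D : ℤ) * (x.val : ℕ) * ((S.D : ℤ) * S.b i) + (v i - S.v' i) + (S.N : ℤ) * S.kLift d i : ℤ)
    : ZMod S.M) = 0

/-- `SameBCond` is decidable (finitely many equalities in `ZMod M`). [folklore] -/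
instance (v : Fin (S.n + 1) → ℤ) (x : ZMod (S.P : ℕ)) (d : Fin S.n → Fin 2) :
    Decidable (S.SameBCond v x d) := by
  unfold SameBCond
  infer_instance

/-- **The coincidence condition depends on the shift only.**  Branch `(j,k)` of `|φ7(b,v′)⟩` meets branch
`(j + x, k + d)` of `|φ7(b,v)⟩` iff `2D²x·b + (v − v′) + N·d ≡ 0 (mod M)`.
[cite: ChenQuantumLattice2024, eq. (35) p. 31] -/
theorem pt7_sameB_eq_iff (v : Fin (S.n + 1) → ℤ) (x : ZMod (S.P : ℕ)) (d : Fin S.n → Fin 2) (j : ℕ)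
    (k : Fin S.n → Fin 2) :
    S.pt7 j k = (S.inst S.b v).pt7 ((x + (j : ZMod (S.P : ℕ))).val) (k + d) ↔ S.SameBCond v x d := by
  obtain ⟨c, hc⟩ := val_add_natCast_eq (S.P : ℕ) x j
  have key : ∀ i,
      ((2 * (S.D : ℤ) * (((x + (j : ZMod (S.P : ℕ))).val : ℕ) : ℤ) * ((S.D : ℤ) * S.b i) + v i
          + (S.N : ℤ) * S.kLift (k + d) i : ℤ) : ZMod S.M)
        - ((2 * (S.D : ℤ) * j * ((S.D : ℤ) * S.b i) + S.v' i + (S.N : ℤ) * S.kLift k i : ℤ) : ZMod S.M)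
      = ((2 * (S.D : ℤ) * (x.val : ℕ) * ((S.D : ℤ) * S.b i) + (v i - S.v' i) + (S.N : ℤ) * S.kLift d i : ℤ)
          : ZMod S.M) := by
    intro i
    rw [← Int.cast_sub, ZMod.intCast_eq_intCast_iff_dvd_sub, S.M_coe]
    rcases Fin.eq_zero_or_eq_succ i with rfl | ⟨t, rfl⟩
    · rw [kLift_zero, kLift_zero, kLift_zero]
      exact ⟨S.b 0 * c, by linear_combination (-(2 * (S.D : ℤ) * S.D * S.b 0)) * hc⟩
    · rw [kLift_succ, kLift_succ, kLift_succ, Pi.add_apply]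
      obtain ⟨w, hw⟩ := fin2_val_add (k t) (d t)
      rw [hw, S.N_coe]
      exact ⟨S.b t.succ * c + w, by linear_combination (-(2 * (S.D : ℤ) * S.D * S.b t.succ)) * hc⟩
  constructor
  · intro heq i
    have hi : ((2 * (S.D : ℤ) * j * ((S.D : ℤ) * S.b i) + S.v' i + (S.N : ℤ) * S.kLift k i : ℤ) : ZMod S.M)
        = ((2 * (S.D : ℤ) * (((x + (j : ZMod (S.P : ℕ))).val : ℕ) : ℤ) * ((S.D : ℤ) * S.b i) + v i
            + (S.N : ℤ) * S.kLift (k + d) i : ℤ) : ZMod S.M) := congr_fun heq i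
    rw [← key i, hi, sub_self]
  · intro hC
    funext i
    show ((2 * (S.D : ℤ) * j * ((S.D : ℤ) * S.b i) + S.v' i + (S.N : ℤ) * S.kLift k i : ℤ) : ZMod S.M)
        = ((2 * (S.D : ℤ) * (((x + (j : ZMod (S.P : ℕ))).val : ℕ) : ℤ) * ((S.D : ℤ) * S.b i) + v i
            + (S.N : ℤ) * S.kLift (k + d) i : ℤ) : ZMod S.M)
    have := key i
    rw [hC i, sub_eq_zero] at this
    exact this.symm

/-- The shift-zero condition is `v ≡ v′ (mod M)`. [cite: ChenQuantumLattice2024, eq. (35) p. 31] -/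
theorem sameBCond_zero_iff (v : Fin (S.n + 1) → ℤ) :
    S.SameBCond v 0 0 ↔ ∀ i, ((v i : ℤ) : ZMod S.M) = ((S.v' i : ℤ) : ZMod S.M) := by
  have hk : ∀ i, S.kLift 0 i = 0 := by
    intro i
    rcases Fin.eq_zero_or_eq_succ i with rfl | ⟨t, rfl⟩
    · exact S.kLift_zero _
    · rw [kLift_succ]
      rfl
  unfold SameBCond
  refine forall_congr' fun i => ?_
  rw [hk i, ZMod.val_zero]
  push_cast
  rw [show (2 * (S.D : ZMod S.M) * 0 * ((S.D : ZMod S.M) * (S.b i : ZMod S.M)) + ((v i : ZMod S.M) - (S.v' i))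
      + (S.N : ZMod S.M) * 0) = (v i : ZMod S.M) - S.v' i by ring, sub_eq_zero]

/-- The general amplitude product `conj(amp7 j k)·amp7 j′ k′ = e((j² − j′²)/P)·e((‖k′‖² − ‖k‖²)/4)`.
[cite: ChenQuantumLattice2024, eq. (35) p. 31] -/
theorem conj_amp7_mul_amp7' (j j' : ℕ) (k k' : Fin S.n → Fin 2) :
    (starRingEnd ℂ) (S.amp7 j k) * S.amp7 j' k'
      = e ((((j : ℚ)) ^ 2 - ((j' : ℚ)) ^ 2) / S.P)
          * e (((∑ t, ((k' t : ℕ) : ℚ) ^ 2) - ∑ t, ((k t : ℕ) : ℚ) ^ 2) / 4) := by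
  unfold amp7
  rw [map_mul, conj_e, conj_e,
    show ∀ a b c d : ℂ, a * b * (c * d) = (a * c) * (b * d) from fun a b c d => by ring,
    ← e_add, ← e_add]
  congr 2 <;> ring

/-- `e(−1/4) = −i`. [folklore] -/
theorem e_neg_one_div_four : e (-(1 / 4 : ℚ)) = -Complex.I := by
  rw [← conj_e, e_one_div_four, Complex.conj_I]

/-- **The `j`-sum: a complete chirp sum.**  `Σ_{j<P} e((j² − (j+x)²)/P) = P·[x = 0]` (`P` odd).
[cite: ChenQuantumLattice2024, eq. (35) p. 31, Cond. C.3 p. 18] -/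
theorem sum_chirp_shift (h : S.Admissible) (x : ZMod (S.P : ℕ)) :
    ∑ j ∈ Finset.range (S.P : ℕ),
        e ((((j : ℚ)) ^ 2 - ((((x + (j : ZMod (S.P : ℕ))).val : ℕ) : ℚ)) ^ 2) / S.P)
      = if x = 0 then ((S.P : ℕ) : ℂ) else 0 := by
  have hP0 : ((S.P : ℕ) : ℚ) ≠ 0 := by exact_mod_cast S.P.ne_zero
  have hsummand : ∀ j : ℕ,
      e ((((j : ℚ)) ^ 2 - ((((x + (j : ZMod (S.P : ℕ))).val : ℕ) : ℚ)) ^ 2) / S.P)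
        = e (-(((x.val : ℕ) : ℚ) ^ 2) / S.P)
            * e ((((j : ℤ) * (-2 * (x.val : ℕ)) : ℤ) : ℚ) / (S.P : ℕ)) := by
    intro j
    obtain ⟨c, hc⟩ := val_add_natCast_eq (S.P : ℕ) x j
    have hc' : ((((x + (j : ZMod (S.P : ℕ))).val : ℕ)) : ℚ) = ((x.val : ℕ) : ℚ) + j - (S.P : ℕ) * c := by
      exact_mod_cast hc
    rw [← e_add]
    refine e_eq_e_of_sub_eq_intCast
      (c * (((x.val : ℕ) : ℤ) + j + (((x + (j : ZMod (S.P : ℕ))).val : ℕ) : ℤ))) ?_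
    push_cast
    rw [hc']
    field_simp
    ring
  rw [Finset.sum_congr rfl (fun j _ => hsummand j), ← Finset.mul_sum, sum_range_e_mul_div]
  have hx : (((-2 * ((x.val : ℕ) : ℤ) : ℤ)) : ZMod (S.P : ℕ)) = 0 ↔ x = 0 := by
    push_cast
    rw [ZMod.natCast_zmod_val]
    constructor
    · intro h0
      obtain ⟨r, hr⟩ := S.odd_P h
      have hPz : ((2 * r + 1 : ℕ) : ZMod (S.P : ℕ)) = 0 := by
        rw [← hr]
        exact ZMod.natCast_self _
      push_cast at hPz
      have h2 : (2 : ZMod (S.P : ℕ)) * ((r : ℕ) + 1) = 1 := by linear_combination hPz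
      calc x = (2 * ((r : ℕ) + 1 : ZMod (S.P : ℕ))) * x := by rw [h2, one_mul]
        _ = -(((r : ℕ) : ZMod (S.P : ℕ)) + 1) * (-2 * x) := by ring
        _ = 0 := by rw [h0, mul_zero]
    · rintro rfl
      simp
  by_cases hx0 : x = 0
  · subst hx0
    rw [if_pos (hx.2 rfl), if_pos rfl, ZMod.val_zero]
    push_cast
    rw [show (-(0 : ℚ) ^ 2 / ((S.P : ℕ) : ℚ)) = 0 by simp, show e 0 = 1 by simpa using e_intCast 0,
      one_mul]
  · rw [if_neg (mt hx.1 hx0), if_neg hx0, mul_zero]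

/-- **The `k`-sum.**  `Σ_{k ∈ {0,1}ⁿ} e((‖k + d‖² − ‖k‖²)/4) = 2ⁿ·[d = 0]` (a coordinate with `d_t = 1`
contributes `e(1/4) + e(−1/4) = i − i = 0`). [cite: ChenQuantumLattice2024, eq. (35) p. 31] -/
theorem sum_kpart (d : Fin S.n → Fin 2) :
    ∑ k : Fin S.n → Fin 2, e (((∑ t, (((k + d) t : ℕ) : ℚ) ^ 2) - ∑ t, ((k t : ℕ) : ℚ) ^ 2) / 4)
      = if d = 0 then (2 : ℂ) ^ S.n else 0 := by
  classical
  set f : Fin S.n → Fin 2 → ℂ :=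
    fun t c => e (((((c + d t : Fin 2) : ℕ) : ℚ) ^ 2 - ((c : ℕ) : ℚ) ^ 2) / 4) with hf
  have h1 : ∀ k : Fin S.n → Fin 2,
      e (((∑ t, (((k + d) t : ℕ) : ℚ) ^ 2) - ∑ t, ((k t : ℕ) : ℚ) ^ 2) / 4) = ∏ t, f t (k t) := by
    intro k
    rw [hf, ← e_sum]
    congr 1
    rw [← Finset.sum_sub_distrib, Finset.sum_div]
    rfl
  simp_rw [h1]
  rw [← Fintype.prod_sum f]
  have h2 : ∀ t, ∑ c : Fin 2, f t c = if d t = 0 then (2 : ℂ) else 0 := by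
    intro t
    rw [Fin.sum_univ_two, hf]
    simp only []
    rcases Fin.exists_fin_two.1 ⟨d t, rfl⟩ with h0 | h0 <;> rw [h0]
    · rw [if_pos rfl]
      have c00 : (((0 : Fin 2) + 0 : Fin 2) : ℕ) = 0 := by decide
      have c10 : (((1 : Fin 2) + 0 : Fin 2) : ℕ) = 1 := by decide
      have v0 : ((0 : Fin 2) : ℕ) = 0 := by decide
      have v1 : ((1 : Fin 2) : ℕ) = 1 := by decide
      rw [c00, c10, v0, v1]
      push_cast
      rw [show ((0 : ℚ) ^ 2 - 0 ^ 2) / 4 = 0 by norm_num, show ((1 : ℚ) ^ 2 - 1 ^ 2) / 4 = 0 by norm_num,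
        show e 0 = 1 by simpa using e_intCast 0]
      norm_num
    · rw [if_neg (by decide)]
      have c01 : (((0 : Fin 2) + 1 : Fin 2) : ℕ) = 1 := by decide
      have c11 : (((1 : Fin 2) + 1 : Fin 2) : ℕ) = 0 := by decide
      have v0 : ((0 : Fin 2) : ℕ) = 0 := by decide
      have v1 : ((1 : Fin 2) : ℕ) = 1 := by decide
      rw [c01, c11, v0, v1]
      push_cast
      rw [show ((1 : ℚ) ^ 2 - 0 ^ 2) / 4 = 1 / 4 by norm_num,
        show ((0 : ℚ) ^ 2 - 1 ^ 2) / 4 = -(1 / 4) by norm_num, e_one_div_four, e_neg_one_div_four]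
      ring
  simp_rw [h2]
  by_cases hd : d = 0
  · subst hd
    simp
  · rw [if_neg hd]
    obtain ⟨t, ht⟩ : ∃ t, d t ≠ 0 := by
      by_contra hcon
      push Not at hcon
      exact hd (funext hcon)
    exact Finset.prod_eq_zero (Finset.mem_univ t) (if_neg ht)

/-- Swapping a four-fold sum. [folklore] -/
theorem sum_swap4 {α β γ δ : Type*} (s : Finset α) (t : Finset β) (u : Finset γ) (w : Finset δ)
    (G : α → β → γ → δ → ℂ) :
    ∑ a ∈ s, ∑ b ∈ t, ∑ c ∈ u, ∑ d ∈ w, G a b c d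
      = ∑ c ∈ u, ∑ d ∈ w, ∑ a ∈ s, ∑ b ∈ t, G a b c d := by
  calc ∑ a ∈ s, ∑ b ∈ t, ∑ c ∈ u, ∑ d ∈ w, G a b c d
      = ∑ a ∈ s, ∑ c ∈ u, ∑ b ∈ t, ∑ d ∈ w, G a b c d :=
        Finset.sum_congr rfl fun a _ => Finset.sum_comm
    _ = ∑ c ∈ u, ∑ a ∈ s, ∑ b ∈ t, ∑ d ∈ w, G a b c d := Finset.sum_comm
    _ = ∑ c ∈ u, ∑ a ∈ s, ∑ d ∈ w, ∑ b ∈ t, G a b c d :=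
        Finset.sum_congr rfl fun c _ => Finset.sum_congr rfl fun a _ => Finset.sum_comm
    _ = ∑ c ∈ u, ∑ d ∈ w, ∑ a ∈ s, ∑ b ∈ t, G a b c d :=
        Finset.sum_congr rfl fun c _ => Finset.sum_comm

/-- **Same `b`: the exact overlap.**  `⟨φ7(b,v′)|φ7(b,v)⟩ = P·2ⁿ` if `v ≡ v′ (mod M)` and `0` otherwise
(here `S = (b, v′)` and the second instance is `(b, v)`). [cite: ChenQuantumLattice2024, eq. (35) p. 31, Cond. C.3 p. 18] -/
theorem dot_phi7_sameB' (h : S.Admissible) (v : Fin (S.n + 1) → ℤ) :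
    star S.phi7 ⬝ᵥ (S.inst S.b v).phi7
      = if S.SameBCond v 0 0 then ((S.P : ℕ) : ℂ) * 2 ^ S.n else 0 := by
  classical
  rw [star_phi7_dotProduct]
  -- the value of the second state at the points of the first, re-indexed by the shift
  have hval : ∀ j ∈ Finset.range (S.P : ℕ), ∀ k : Fin S.n → Fin 2, (S.inst S.b v).phi7 (S.pt7 j k)
      = ∑ x : ZMod (S.P : ℕ), ∑ d : Fin S.n → Fin 2,
          if S.SameBCond v x d then S.amp7 ((x + (j : ZMod (S.P : ℕ))).val) (k + d) else 0 := by
    intro j _ k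
    rw [phi7_apply]
    refine (S.sum_branches_reindex
      (fun j' k' => if S.pt7 j k = (S.inst S.b v).pt7 j' k' then S.amp7 j' k' else 0) j k).trans ?_
    refine Finset.sum_congr rfl fun x _ => Finset.sum_congr rfl fun d _ => ?_
    by_cases hC : S.SameBCond v x d
    · rw [if_pos hC, if_pos ((S.pt7_sameB_eq_iff v x d j k).2 hC)]
    · rw [if_neg hC, if_neg (mt (S.pt7_sameB_eq_iff v x d j k).1 hC)]
  rw [Finset.sum_congr rfl fun j hj => Finset.sum_congr rfl fun k _ => by rw [hval j hj k]]
  simp_rw [Finset.mul_sum, mul_ite, mul_zero]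
  rw [sum_swap4]
  have pull : ∀ (p : Prop) [Decidable p] (g : ℕ → (Fin S.n → Fin 2) → ℂ),
      (∑ j ∈ Finset.range (S.P : ℕ), ∑ k : Fin S.n → Fin 2, if p then g j k else 0)
        = if p then ∑ j ∈ Finset.range (S.P : ℕ), ∑ k : Fin S.n → Fin 2, g j k else 0 := by
    intro p _ g
    split_ifs <;> simp
  simp_rw [pull, conj_amp7_mul_amp7', ← Finset.sum_mul_sum, S.sum_chirp_shift h, sum_kpart]
  -- evaluate the double sum: only the shift `(0,0)` contributes
  rw [Finset.sum_eq_single (0 : ZMod (S.P : ℕ))]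
  · rw [Finset.sum_eq_single (0 : Fin S.n → Fin 2)]
    · rw [if_pos rfl, if_pos rfl]
    · intro d _ hd
      rw [if_neg hd, mul_zero, ite_self]
    · intro h0
      exact absurd (Finset.mem_univ _) h0
  · intro x _ hx
    refine Finset.sum_eq_zero fun d _ => ?_
    rw [if_neg hx, zero_mul, ite_self]
  · intro h0
    exact absurd (Finset.mem_univ _) h0

/-- **Same `b`: the exact overlap.**  `⟨φ7(b,v′)|φ7(b,v)⟩ = P·2ⁿ·[v ≡ v′ (mod M)]`.
[cite: ChenQuantumLattice2024, eq. (35) p. 31, Cond. C.3 p. 18] -/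
theorem dot_phi7_sameB (h : S.Admissible) (v : Fin (S.n + 1) → ℤ) :
    star S.phi7 ⬝ᵥ (S.inst S.b v).phi7
      = if (∀ i, ((v i : ℤ) : ZMod S.M) = ((S.v' i : ℤ) : ZMod S.M)) then ((S.P : ℕ) : ℂ) * 2 ^ S.n
        else 0 := by
  rw [dot_phi7_sameB' S h v]
  exact if_congr (S.sameBCond_zero_iff v) rfl rfl

/-- **Same `b` up to `P`: the exact overlap of `|φ7.d⟩`'s.**  If `b₃ ≡ b₂ (mod P)` coordinatewise then
`⟨φ7.d(b₂,v₂)|φ7.d(b₃,v₃)⟩ = ⟨φ7.d|φ7.d⟩·[v₃ ≡ v₂ (mod M)]`. [cite: ChenQuantumLattice2024, eq. (35) p. 31, §3.5.8 p. 33] -/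
theorem dot_phi7d_congr_b (h : S.Admissible) {b₂ v₂ b₃ v₃ : Fin (S.n + 1) → ℤ}
    (h₂ : (S.inst b₂ v₂).Admissible) (h₃ : (S.inst b₃ v₃).Admissible)
    (hb : ∀ i, ((S.P : ℕ) : ℤ) ∣ b₃ i - b₂ i) :
    star (S.inst b₂ v₂).phi7d ⬝ᵥ (S.inst b₃ v₃).phi7d
      = if (∀ i, ((v₃ i : ℤ) : ZMod S.M) = ((v₂ i : ℤ) : ZMod S.M))
        then star (S.inst b₂ v₂).phi7d ⬝ᵥ (S.inst b₂ v₂).phi7d else 0 := by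
  rw [S.phi7d_inst_congr_b v₃ hb]
  have h₃' : (S.inst b₂ v₃).Admissible :=
    S.inst_admissible h h₂.b_head h₂.b_tail h₃.v'_in_DZ
  rw [dot_phi7d_inst_phi7 b₂ v₂ b₂ v₃ h₃', star_phi7d_dotProduct_phi7d_inst h₂]
  have key : star (S.inst b₂ v₂).phi7 ⬝ᵥ (S.inst b₂ v₃).phi7
      = if (∀ i, ((v₃ i : ℤ) : ZMod S.M) = ((v₂ i : ℤ) : ZMod S.M)) then ((S.P : ℕ) : ℂ) * 2 ^ S.n
        else 0 :=
    (S.inst b₂ v₂).dot_phi7_sameB h₂ v₃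
  rw [key]
  split_ifs with hv
  · rfl
  · rw [mul_zero]

end Shape

/-! ## Part VI.  The witness measurement: `{|ψ⟩⟨ψ|/⟨ψ|ψ⟩, 1 − |ψ⟩⟨ψ|/⟨ψ|ψ⟩}` along `ψ = |φ7.d⟩` of `S` -/

section RankOne

variable {X : Type*} [Fintype X]

/-- The effect `|ψ⟩⟨ψ|/⟨ψ|ψ⟩`. [cite: NielsenChuang2010, §2.2.6 p. 90] -/
noncomputable def projEffect (ψ : X → ℂ) : Matrix X X ℂ :=
  ((((star ψ ⬝ᵥ ψ).re)⁻¹ : ℝ) : ℂ) • Matrix.vecMulVec ψ (star ψ)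

/-- `(|ψ⟩⟨ψ|/⟨ψ|ψ⟩)|φ⟩ = (⟨ψ|φ⟩/⟨ψ|ψ⟩)|ψ⟩`. [cite: NielsenChuang2010, §2.2.6 p. 90] -/
theorem projEffect_mulVec (ψ φ : X → ℂ) :
    projEffect ψ *ᵥ φ = (((((star ψ ⬝ᵥ ψ).re)⁻¹ : ℝ) : ℂ) * (star ψ ⬝ᵥ φ)) • ψ := by
  unfold projEffect
  rw [Matrix.smul_mulVec, Matrix.vecMulVec_mulVec, op_smul_eq_smul, smul_smul]

/-- `⟨φ|ψ⟩ = conj ⟨ψ|φ⟩`. [folklore] -/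
theorem star_dotProduct_comm_conj (ψ φ : X → ℂ) : star φ ⬝ᵥ ψ = (starRingEnd ℂ) (star ψ ⬝ᵥ φ) := by
  simp only [dotProduct, Pi.star_apply, Complex.star_def, map_sum, map_mul, Complex.conj_conj]
  exact Finset.sum_congr rfl fun i _ => mul_comm _ _

/-- `⟨χ|(|ψ⟩⟨ψ|/⟨ψ|ψ⟩)|φ⟩ = ⟨ψ|φ⟩⟨χ|ψ⟩/⟨ψ|ψ⟩`. [cite: NielsenChuang2010, §2.2.6 p. 90] -/
theorem dotProduct_projEffect_mulVec (ψ φ χ : X → ℂ) :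
    star χ ⬝ᵥ (projEffect ψ *ᵥ φ)
      = ((((star ψ ⬝ᵥ ψ).re)⁻¹ : ℝ) : ℂ) * ((star ψ ⬝ᵥ φ) * (star χ ⬝ᵥ ψ)) := by
  rw [projEffect_mulVec, dotProduct_smul, smul_eq_mul]
  ring

/-- `⟨ψ|ψ⟩` is the real number `(⟨ψ|ψ⟩).re`. [folklore] -/
theorem star_dotProduct_self_eq_re (ψ : X → ℂ) : star ψ ⬝ᵥ ψ = (((star ψ ⬝ᵥ ψ).re : ℝ) : ℂ) :=
  Complex.ext (by simp) (by simp [star_dotProduct_self_im])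

/-- The quadratic form of `|ψ⟩⟨ψ|/⟨ψ|ψ⟩`: `⟨φ|E₀|φ⟩ = ‖⟨ψ|φ⟩‖²/⟨ψ|ψ⟩` (a non-negative real).
[cite: NielsenChuang2010, §2.2.6 p. 90] -/
theorem dotProduct_projEffect_mulVec_self (ψ φ : X → ℂ) :
    star φ ⬝ᵥ (projEffect ψ *ᵥ φ) = (((((star ψ ⬝ᵥ ψ).re)⁻¹ * ‖star ψ ⬝ᵥ φ‖ ^ 2 : ℝ)) : ℂ) := by
  rw [dotProduct_projEffect_mulVec, star_dotProduct_comm_conj ψ φ, Complex.mul_conj']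
  push_cast
  ring

/-- `|ψ⟩⟨ψ|/⟨ψ|ψ⟩` is Hermitian. [cite: NielsenChuang2010, §2.2.6 p. 90] -/
theorem isHermitian_projEffect (ψ : X → ℂ) : (projEffect ψ).IsHermitian := by
  unfold projEffect
  show (_ : Matrix X X ℂ)ᴴ = _
  rw [Matrix.conjTranspose_smul, Matrix.conjTranspose_vecMulVec, star_star, Complex.star_def,
    Complex.conj_ofReal]

/-- `|ψ⟩⟨ψ|/⟨ψ|ψ⟩ ≥ 0`. [cite: NielsenChuang2010, §2.2.6 p. 90] -/
theorem posSemidef_projEffect (ψ : X → ℂ) : (projEffect ψ).PosSemidef := by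
  refine Matrix.PosSemidef.of_dotProduct_mulVec_nonneg (isHermitian_projEffect ψ) fun x => ?_
  rw [dotProduct_projEffect_mulVec_self]
  exact Complex.zero_le_real.2
    (mul_nonneg (inv_nonneg.2 (star_dotProduct_self_re_nonneg ψ)) (sq_nonneg _))

variable [DecidableEq X]

/-- `1 − |ψ⟩⟨ψ|/⟨ψ|ψ⟩ ≥ 0` (Cauchy–Schwarz). [cite: NielsenChuang2010, §2.2.6 p. 90] -/
theorem posSemidef_one_sub_projEffect (ψ : X → ℂ) : (1 - projEffect ψ).PosSemidef := by
  refine Matrix.PosSemidef.of_dotProduct_mulVec_nonneg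
    (Matrix.isHermitian_one.sub (isHermitian_projEffect ψ)) fun x => ?_
  rw [Matrix.sub_mulVec, Matrix.one_mulVec, dotProduct_sub, dotProduct_projEffect_mulVec_self,
    star_dotProduct_self_eq_re x, ← Complex.ofReal_sub]
  refine Complex.zero_le_real.2 (sub_nonneg.2 ?_)
  have hcs := norm_sq_star_dotProduct_le ψ x
  rcases (star_dotProduct_self_re_nonneg ψ).lt_or_eq with hpos | h0
  · rw [inv_mul_le_iff₀ hpos]
    exact hcs
  · rw [← h0, _root_.inv_zero, zero_mul]
    exact star_dotProduct_self_re_nonneg x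

/-- **The rank-one measurement along `ψ`:** outcome `0` with effect `|ψ⟩⟨ψ|/⟨ψ|ψ⟩`, outcome `1` with the
complementary effect. [cite: NielsenChuang2010, §2.2.6 p. 90] -/
noncomputable def rankOnePOVM (ψ : X → ℂ) : POVM X (Fin 2) where
  effect := fun k => if k = 0 then projEffect ψ else 1 - projEffect ψ
  posSemidef := fun k => by
    by_cases hk : k = 0
    · rw [if_pos hk]
      exact posSemidef_projEffect ψ
    · rw [if_neg hk]
      exact posSemidef_one_sub_projEffect ψ
  sum_eq_one := by
    rw [Fin.sum_univ_two, if_pos rfl, if_neg (by decide)]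
    abel

/-- Weight of outcome `0` on `φ`: `‖⟨ψ|φ⟩‖²/⟨ψ|ψ⟩`. [cite: NielsenChuang2010, §2.2.6 p. 90] -/
theorem rankOnePOVM_weight_zero (ψ φ : X → ℂ) :
    (rankOnePOVM ψ).weight φ 0 = (((((star ψ ⬝ᵥ ψ).re)⁻¹ * ‖star ψ ⬝ᵥ φ‖ ^ 2 : ℝ)) : ℂ) := by
  show star φ ⬝ᵥ ((if (0 : Fin 2) = 0 then projEffect ψ else 1 - projEffect ψ) *ᵥ φ) = _
  rw [if_pos rfl, dotProduct_projEffect_mulVec_self]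

/-- Weight of outcome `1` on `φ`: `⟨φ|φ⟩ − ‖⟨ψ|φ⟩‖²/⟨ψ|ψ⟩`. [cite: NielsenChuang2010, §2.2.6 p. 90] -/
theorem rankOnePOVM_weight_one (ψ φ : X → ℂ) :
    (rankOnePOVM ψ).weight φ 1
      = star φ ⬝ᵥ φ - (((((star ψ ⬝ᵥ ψ).re)⁻¹ * ‖star ψ ⬝ᵥ φ‖ ^ 2 : ℝ)) : ℂ) := by
  show star φ ⬝ᵥ ((if (1 : Fin 2) = 0 then projEffect ψ else 1 - projEffect ψ) *ᵥ φ) = _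
  rw [if_neg (by decide), Matrix.sub_mulVec, Matrix.one_mulVec, dotProduct_sub,
    dotProduct_projEffect_mulVec_self]

/-- Outcome `0` is certain on `ψ` itself (`ψ ≠ 0`). [cite: NielsenChuang2010, §2.2.6 p. 90] -/
theorem rankOnePOVM_certain_self {ψ : X → ℂ} (hψ : ψ ≠ 0) : (rankOnePOVM ψ).Certain ψ 0 := by
  unfold POVM.Certain
  rw [rankOnePOVM_weight_zero]
  conv_rhs => rw [star_dotProduct_self_eq_re ψ]
  congr 1
  rw [star_dotProduct_self_eq_re ψ, Complex.ofReal_re, Complex.norm_real, Real.norm_eq_abs, sq_abs,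
    pow_two, ← mul_assoc, inv_mul_cancel₀ (star_dotProduct_self_re_pos hψ).ne', one_mul]

/-- Outcome `1` is certain on any `φ ⊥ ψ`. [cite: NielsenChuang2010, §2.2.6 p. 90] -/
theorem rankOnePOVM_certain_of_orthogonal {ψ φ : X → ℂ} (h0 : star ψ ⬝ᵥ φ = 0) :
    (rankOnePOVM ψ).Certain φ 1 := by
  unfold POVM.Certain
  rw [rankOnePOVM_weight_one, h0, norm_zero]
  simp

/-- Outcome `1` is `ε`-almost certain on `φ` as soon as `‖⟨ψ|φ⟩‖² ≤ ε·⟨ψ|ψ⟩·⟨φ|φ⟩`.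
[cite: NielsenChuang2010, §2.2.6 p. 90] -/
theorem rankOnePOVM_almostCertain_one {ψ φ : X → ℂ} (hψ : ψ ≠ 0) {ε : ℝ}
    (hz : ‖star ψ ⬝ᵥ φ‖ ^ 2 ≤ ε * (star ψ ⬝ᵥ ψ).re * (star φ ⬝ᵥ φ).re) :
    (rankOnePOVM ψ).AlmostCertain ε φ 1 := by
  unfold POVM.AlmostCertain
  rw [rankOnePOVM_weight_one, Complex.sub_re, Complex.ofReal_re]
  have hpos := star_dotProduct_self_re_pos hψ
  have h1 : ((star ψ ⬝ᵥ ψ).re)⁻¹ * ‖star ψ ⬝ᵥ φ‖ ^ 2 ≤ ε * (star φ ⬝ᵥ φ).re := by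
    rw [inv_mul_le_iff₀ hpos]
    calc ‖star ψ ⬝ᵥ φ‖ ^ 2 ≤ ε * (star ψ ⬝ᵥ ψ).re * (star φ ⬝ᵥ φ).re := hz
      _ = (star ψ ⬝ᵥ ψ).re * (ε * (star φ ⬝ᵥ φ).re) := by ring
  linarith

end RankOne

namespace Shape

variable (S : Shape)

/-! ## Part VII.  The order of the tolerance: necessity of `ε < 1/minFac(Q)²` -/

/-- The rank-one measurement along `|φ7.d⟩` of `S` is `(1/minFac(Q)²)`-almost sure on EVERY admissible
instance of the same shape (any class `U`): an instance whose `b` is congruent to `S.b` modulo `P`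
coordinatewise is either the same state (outcome `0` certain) or orthogonal to it (outcome `1` certain), and
any other admissible instance has normalised overlap at most `1/minFac(Q)²` with `S` (outcome `1` almost
certain).  Adjudication (b2b Part 1, generation 8). [cite: ChenQuantumLattice2024, §3.5.5 pp. 33–37, Cond. C.3–C.5 p. 18] -/
theorem rankOne_almostSureOn (h : S.Admissible) (U : Finset (Fin (S.n + 1))) :
    S.AlmostSureOn (1 / ((Nat.minFac (S.Q : ℕ) : ℕ) : ℝ) ^ 2) U (rankOnePOVM S.phi7d) := by
  classical
  have hε0 : (0 : ℝ) ≤ 1 / ((Nat.minFac (S.Q : ℕ) : ℕ) : ℝ) ^ 2 := by positivity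
  have hψ : S.phi7d ≠ 0 := S.phi7d_ne_zero h
  rintro b₂ v₂ ⟨-, h₂⟩
  have hS : (S.inst S.b S.v').Admissible := h
  -- tail differences are multiples of `2p₁`
  have hμ : ∀ t : Fin S.n, ∃ μ : ℤ, S.b t.succ - b₂ t.succ = 2 * (S.p₁ : ℤ) * μ := by
    intro t
    obtain ⟨a, ha⟩ := h.b_tail t.succ (Fin.succ_ne_zero t)
    obtain ⟨c, hc⟩ := h₂.b_tail t.succ (Fin.succ_ne_zero t)
    have hc' : b₂ t.succ = 2 * (S.p₁ : ℤ) * c := hc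
    exact ⟨a - c, by rw [ha, hc']; ring⟩
  choose μ hμ using hμ
  by_cases hall : ∀ t : Fin S.n, ((S.Q : ℕ) : ℤ) ∣ μ t
  · -- `b₂ ≡ S.b (mod P)` coordinatewise
    have hb : ∀ i, ((S.P : ℕ) : ℤ) ∣ b₂ i - S.b i := by
      intro i
      rcases Fin.eq_zero_or_eq_succ i with rfl | ⟨t, rfl⟩
      · have hb0 : b₂ 0 = -1 := h₂.b_head
        rw [hb0, h.b_head, sub_self]
        exact dvd_zero _
      · obtain ⟨c, hc⟩ := hall t
        refine ⟨-(2 * c), ?_⟩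
        rw [S.P_coe]
        linear_combination (-1 : ℤ) * hμ t - (2 * (S.p₁ : ℤ)) * hc
    have hov := S.dot_phi7d_congr_b h hS h₂ hb
    by_cases hv : ∀ i, ((v₂ i : ℤ) : ZMod S.M) = ((S.v' i : ℤ) : ZMod S.M)
    · -- the same state
      have hstate : (S.inst b₂ v₂).phi7d = S.phi7d := by
        rw [S.phi7d_inst_congr_b v₂ hb]
        exact S.phi7d_inst_congr S.b S.v' v₂ hv
      refine ⟨0, POVM.Certain.almostCertain _ ?_ hε0⟩
      rw [hstate]
      exact rankOnePOVM_certain_self hψ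
    · -- orthogonal
      have h0 : star S.phi7d ⬝ᵥ (S.inst b₂ v₂).phi7d = 0 := by
        have := hov
        rw [if_neg hv] at this
        exact this
      exact ⟨1, POVM.Certain.almostCertain _ (rankOnePOVM_certain_of_orthogonal h0) hε0⟩
  · -- some tail coordinate carries a shift not divisible by `Q`: small overlap
    push Not at hall
    obtain ⟨t, ht⟩ := hall
    have hle := S.norm_dot_phi7_mul_minFac_le h (b₂ := S.b) (v₂ := S.v') (b₃ := b₂) (v₃ := v₂) hS h₂ t
      (hμ t) ht
    refine ⟨1, rankOnePOVM_almostCertain_one hψ ?_⟩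
    -- the numbers
    have hd : star S.phi7d ⬝ᵥ (S.inst b₂ v₂).phi7d
        = (((S.M : ℕ) : ℂ) * (S.D : ℕ)) ^ (S.n + 1) * (star S.phi7 ⬝ᵥ (S.inst b₂ v₂).phi7) :=
      S.dot_phi7d_inst_phi7 S.b S.v' b₂ v₂ h₂
    have hnS : star S.phi7d ⬝ᵥ S.phi7d
        = (((S.M : ℕ) : ℂ) * (S.D : ℕ)) ^ (S.n + 1) * (((S.P : ℕ) : ℂ) * 2 ^ S.n) :=
      S.star_phi7d_dotProduct_phi7d_inst (b := S.b) (v := S.v') hS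
    have hn₂ : star ((S.inst b₂ v₂).phi7d : (Fin (S.n + 1) → ZMod S.M) → ℂ)
          ⬝ᵥ ((S.inst b₂ v₂).phi7d : (Fin (S.n + 1) → ZMod S.M) → ℂ)
        = (((S.M : ℕ) : ℂ) * (S.D : ℕ)) ^ (S.n + 1) * (((S.P : ℕ) : ℂ) * 2 ^ S.n) :=
      S.star_phi7d_dotProduct_phi7d_inst h₂
    set K : ℝ := (((S.M : ℕ) : ℝ) * (S.D : ℕ)) ^ (S.n + 1) with hK
    set A : ℝ := ‖star S.phi7 ⬝ᵥ (S.inst b₂ v₂).phi7‖ with hA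
    set B : ℝ := ((S.P : ℕ) : ℝ) * 2 ^ S.n with hB
    set m : ℝ := ((Nat.minFac (S.Q : ℕ) : ℕ) : ℝ) with hm
    have hKnn : 0 ≤ K := by positivity
    have hAnn : 0 ≤ A := norm_nonneg _
    have hmpos : 0 < m := by
      have := Nat.minFac_pos (S.Q : ℕ)
      positivity
    have hnorm : ‖star S.phi7d ⬝ᵥ (S.inst b₂ v₂).phi7d‖ = K * A := by
      rw [hd, norm_mul, norm_pow, norm_mul, Complex.norm_natCast, Complex.norm_natCast]
    have hcast : (((S.M : ℕ) : ℂ) * (S.D : ℕ)) ^ (S.n + 1) * (((S.P : ℕ) : ℂ) * 2 ^ S.n)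
        = ((K * B : ℝ) : ℂ) := by
      rw [hK, hB]
      push_cast
      ring
    have hreS : (star S.phi7d ⬝ᵥ S.phi7d).re = K * B := by
      rw [hnS, hcast, Complex.ofReal_re]
    have hre₂ : (star ((S.inst b₂ v₂).phi7d : (Fin (S.n + 1) → ZMod S.M) → ℂ)
          ⬝ᵥ ((S.inst b₂ v₂).phi7d : (Fin (S.n + 1) → ZMod S.M) → ℂ)).re = K * B := by
      rw [hn₂, hcast, Complex.ofReal_re]
    have h2 : K * A ≤ K * B / m := by
      rw [le_div_iff₀ hmpos]
      calc K * A * m = K * (A * m) := by ring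
        _ ≤ K * B := mul_le_mul_of_nonneg_left hle hKnn
    have h3 : 0 ≤ K * A := mul_nonneg hKnn hAnn
    have key : (K * A) ^ 2 ≤ 1 / m ^ 2 * (K * B) * (K * B) :=
      calc (K * A) ^ 2 ≤ (K * B / m) ^ 2 := pow_le_pow_left₀ h3 h2 2
        _ = 1 / m ^ 2 * (K * B) * (K * B) := by
          field_simp
    calc ‖star S.phi7d ⬝ᵥ (S.inst b₂ v₂).phi7d‖ ^ 2 = (K * A) ^ 2 := by rw [hnorm]
      _ ≤ 1 / m ^ 2 * (K * B) * (K * B) := key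
      _ = 1 / m ^ 2 * (star S.phi7d ⬝ᵥ S.phi7d).re
            * (star ((S.inst b₂ v₂).phi7d : (Fin (S.n + 1) → ZMod S.M) → ℂ)
                ⬝ᵥ ((S.inst b₂ v₂).phi7d : (Fin (S.n + 1) → ZMod S.M) → ℂ)).re := by
          rw [hreS, hre₂]

/-- The companion instance `(b, v′ + 2D²p₁·b)` — same Step-8 output, different Step-9 need
(`Shape.step8_cannot_supply_step9Needs_povm`) — is ORTHOGONAL to `S`, so the rank-one measurement along
`|φ7.d⟩` of `S` returns outcome `1` on it with certainty (and outcome `0` on `S`).  Adjudication.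
[cite: ChenQuantumLattice2024, §3.5.5 pp. 33–37, Lemma 3.13 p. 32] -/
theorem rankOne_separates (h : S.Admissible) :
    (rankOnePOVM S.phi7d).Certain S.phi7d 0
      ∧ (rankOnePOVM S.phi7d).Certain
          (S.inst S.b (fun i => S.v' i + 2 * (S.D : ℤ) * S.D * S.p₁ * S.b i)).phi7d 1 := by
  classical
  have hS : (S.inst S.b S.v').Admissible := h
  have h₃ : (S.inst S.b (fun i => S.v' i + 2 * (S.D : ℤ) * S.D * S.p₁ * S.b i)).Admissible :=
    S.inst_admissible h h.b_head h.b_tail fun i =>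
      dvd_add (h.v'_in_DZ i) ⟨2 * S.D * S.p₁ * S.b i, by ring⟩
  refine ⟨rankOnePOVM_certain_self (S.phi7d_ne_zero h), rankOnePOVM_certain_of_orthogonal ?_⟩
  have hov := S.dot_phi7d_congr_b h hS h₃ (fun i => ⟨0, by ring⟩)
  have hv : ¬ ∀ i, (((S.v' i + 2 * (S.D : ℤ) * S.D * S.p₁ * S.b i : ℤ)) : ZMod S.M)
      = ((S.v' i : ℤ) : ZMod S.M) := by
    intro hall
    have h0 := hall 0
    rw [ZMod.intCast_eq_intCast_iff_dvd_sub, h.b_head, S.M_coe, S.P_coe] at h0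
    obtain ⟨c, hc⟩ := h0
    have hD : (0 : ℤ) < S.D := by exact_mod_cast S.D.pos
    have hp : (0 : ℤ) < S.p₁ := by exact_mod_cast S.p₁.pos
    have hQ3 : (3 : ℤ) ≤ S.Q := by exact_mod_cast h.three_le_Q
    have hc' : (S.D : ℤ) * S.D * S.p₁ * (2 - 2 * S.Q * c) = 0 := by linear_combination hc
    have h2 : (2 : ℤ) - 2 * S.Q * c = 0 := by
      rcases mul_eq_zero.1 hc' with h1 | h1
      · exfalso
        have : (0 : ℤ) < (S.D : ℤ) * S.D * S.p₁ := by positivity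
        exact this.ne' h1
      · exact h1
    rcases lt_trichotomy c 0 with hc0 | hc0 | hc0
    · nlinarith
    · rw [hc0, mul_zero] at h2
      norm_num at h2
    · nlinarith
  have := hov
  rw [if_neg hv] at this
  exact this

/-- **The order of the tolerance (necessity side).**  The conclusion of `Shape.step8_povm_ceiling_sharp`
/ `Shape.step8_cannot_supply_step9Needs_povm_sharp` — "an `ε`-almost-sure measurement gives `S` and
`(b, v′ + 2D²p₁b)` the same almost-certain outcome" — FAILS at `ε₀ = 1/minFac(Q)²`, for every class `U`:
the rank-one measurement along `|φ7.d⟩` is `ε₀`-almost sure on the class and separates the two with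
certainty.  Together with the sufficiency at `4εQ² < 1` this pins the admissible tolerance for PRIME `Q`
to the window `[1/(4Q²), 1/Q²]`, i.e. order EXACTLY `1/Q²` — inverse-polynomial in `Q` alone, not in
`P = p₁Q`; module (P)'s `4εP² < 1` was an undercount of the coincidences.  For composite `Q` the exact
order (between "a coprime factorisation `Q = A·B` with `4εA², 4εB² < 1`" and `1/minFac(Q)²`) is left OPEN.
Adjudication, not a claim of the source. [cite: ChenQuantumLattice2024, §3.5.5 pp. 33–37, Lemma 3.13 p. 32, §3.5.9 p. 37] -/
theorem step8_povm_ceiling_fails_at_inv_minFac_sq (h : S.Admissible) (U : Finset (Fin (S.n + 1))) :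
    ∃ (E : POVM (Fin (S.n + 1) → ZMod S.M) (Fin 2)) (k k' : Fin 2),
      S.AlmostSureOn (1 / ((Nat.minFac (S.Q : ℕ) : ℕ) : ℝ) ^ 2) U E ∧ k ≠ k'
      ∧ E.AlmostCertain (1 / ((Nat.minFac (S.Q : ℕ) : ℕ) : ℝ) ^ 2) S.phi7d k
      ∧ E.AlmostCertain (1 / ((Nat.minFac (S.Q : ℕ) : ℕ) : ℝ) ^ 2)
          (S.inst S.b (fun i => S.v' i + 2 * (S.D : ℤ) * S.D * S.p₁ * S.b i)).phi7d k' := by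
  have hε0 : (0 : ℝ) ≤ 1 / ((Nat.minFac (S.Q : ℕ) : ℕ) : ℝ) ^ 2 := by positivity
  obtain ⟨h0, h1⟩ := S.rankOne_separates h
  exact ⟨rankOnePOVM S.phi7d, 0, 1, S.rankOne_almostSureOn h U, by decide,
    POVM.Certain.almostCertain _ h0 hε0, POVM.Certain.almostCertain _ h1 hε0⟩

/-- **Prime `Q`: the tolerance is of order exactly `1/Q²`.**  Sufficiency at `4εQ² < 1`
(`Shape.step8_cannot_supply_step9Needs_povm_sharp`) and failure at `ε = 1/Q²`.  Adjudication.
[cite: ChenQuantumLattice2024, §3.5.5 pp. 33–37, Lemma 3.13 p. 32] -/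
theorem step8_povm_ceiling_order_prime (h : S.Admissible) (hQ : Nat.Prime (S.Q : ℕ))
    (U : Finset (Fin (S.n + 1))) :
    (∀ {κ : Type} [Fintype κ] [DecidableEq κ] (t₁ : Fin S.n), t₁.succ ∈ U →
        ∀ (E : POVM (Fin (S.n + 1) → ZMod S.M) κ) {ε : ℝ}, 4 * ε * ((S.Q : ℕ) : ℝ) ^ 2 < 1 →
          S.AlmostSureOn ε U E →
            ∀ k k' : κ, E.AlmostCertain ε S.phi7d k →
              E.AlmostCertain ε (S.inst S.b (fun i => S.v' i + 2 * (S.D : ℤ) * S.D * S.p₁ * S.b i)).phi7d k'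
                → k = k')
    ∧ ∃ (E : POVM (Fin (S.n + 1) → ZMod S.M) (Fin 2)) (k k' : Fin 2),
        S.AlmostSureOn (1 / ((S.Q : ℕ) : ℝ) ^ 2) U E ∧ k ≠ k'
        ∧ E.AlmostCertain (1 / ((S.Q : ℕ) : ℝ) ^ 2) S.phi7d k
        ∧ E.AlmostCertain (1 / ((S.Q : ℕ) : ℝ) ^ 2)
            (S.inst S.b (fun i => S.v' i + 2 * (S.D : ℤ) * S.D * S.p₁ * S.b i)).phi7d k' := by
  refine ⟨fun t₁ ht₁ E ε hε hE k k' hk hk' => ?_, ?_⟩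
  · have h₃' : (S.inst S.b (fun i => S.v' i + 2 * (S.D : ℤ) * S.D * S.p₁ * S.b i)).Admissible :=
      S.inst_admissible h h.b_head h.b_tail fun i =>
        dvd_add (h.v'_in_DZ i) ⟨2 * S.D * S.p₁ * S.b i, by ring⟩
    have hS : S.InClass U S.b S.v' := ⟨fun _ _ => rfl, h⟩
    have hS₃ : S.InClass U S.b (fun i => S.v' i + 2 * (S.D : ℤ) * S.D * S.p₁ * S.b i) :=
      ⟨fun _ _ => rfl, h₃'⟩
    exact S.step8_povm_ceiling_sharp h U t₁ ht₁ E hε hE hS hS₃ 1 (fun _ => 0) rfl (fun _ _ => rfl)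
      (fun i => by push_cast; ring) hk hk'
  · have hm : Nat.minFac (S.Q : ℕ) = (S.Q : ℕ) := hQ.minFac_eq
    have := S.step8_povm_ceiling_fails_at_inv_minFac_sq h U
    rw [hm] at this
    exact this

/-! ## Part VIII.  Several coprime levels: tolerance `4ε·qᵢ² < 1` for each level of a Bezout family

For the source's own parameters `Q = p₂⋯p_κ` is a product of SMALL pairwise coprime odd numbers (Cond. C.3,
p. 18: `κ ∈ O(log n)`, `pᵢ ≤ log n`), so the one-level tolerance `4εQ² < 1` is weak.  The chain argument
localises: it suffices that `4ε·qᵢ² < 1` for every member of a family of divisors `qᵢ ∣ Q` whose cofactors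
`Q/qᵢ` generate `ℤ` (Bezout) — e.g. any factorisation of `Q` into pairwise coprime factors, in particular
`{p₂, …, p_κ}` itself: tolerance `4ε·(max pᵢ)² < 1`, inverse-POLYLOGARITHMIC in `n` under Cond. C.3. -/

/-- Offset invariance of the almost-certain outcome, generator `G ∈ ℤ`: within the class, `(b₂, v₂)` and
`(b₂, v₃)` receive the same `ε`-almost-certain outcome whenever `v₃ ≡ v₂ + 2D²p₁·G·(a·b₂ + m) (mod M)`,
`a ∈ ℤ`, `m` supported on `U ∖ {0}`. Adjudication device. [cite: ChenQuantumLattice2024, Lemma 3.13 pp. 32–34, eq. (35) p. 31] -/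
def OffsetInvariant (U : Finset (Fin (S.n + 1))) {κ : Type*} [Fintype κ] [DecidableEq κ]
    (E : POVM (Fin (S.n + 1) → ZMod S.M) κ) (ε : ℝ) (G : ℤ) : Prop :=
  ∀ ⦃b₂ v₂ v₃ : Fin (S.n + 1) → ℤ⦄, S.InClass U b₂ v₂ →
    ∀ (a : ℤ) (m : Fin (S.n + 1) → ℤ), m 0 = 0 → (∀ i, i ∉ U → m i = 0) →
      (∀ i, ((v₃ i : ℤ) : ZMod S.M)
          = ((v₂ i + 2 * (S.D : ℤ) * S.D * S.p₁ * G * (a * b₂ i + m i) : ℤ) : ZMod S.M)) →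
        ∀ ⦃k₂ k₃ : κ⦄, E.AlmostCertain ε (S.inst b₂ v₂).phi7d k₂ →
          E.AlmostCertain ε (S.inst b₂ v₃).phi7d k₃ → k₂ = k₃

/-- Slope invariance of the almost-certain outcome, generator `G ∈ ℤ`: two class instances with the same
offsets and `b`'s congruent modulo `2p₁G` on the tail receive the same `ε`-almost-certain outcome.
Adjudication device. [cite: ChenQuantumLattice2024, Lemma 3.13 pp. 32–34, eq. (35) p. 31] -/
def SlopeInvariant (U : Finset (Fin (S.n + 1))) {κ : Type*} [Fintype κ] [DecidableEq κ]
    (E : POVM (Fin (S.n + 1) → ZMod S.M) κ) (ε : ℝ) (G : ℤ) : Prop :=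
  ∀ ⦃b₂ b₃ w : Fin (S.n + 1) → ℤ⦄, S.InClass U b₂ w → S.InClass U b₃ w →
    (∀ i, i ≠ 0 → (2 * (S.p₁ : ℤ) * G) ∣ b₂ i - b₃ i) →
      ∀ ⦃k₂ k₃ : κ⦄, E.AlmostCertain ε (S.inst b₂ w).phi7d k₂ →
        E.AlmostCertain ε (S.inst b₃ w).phi7d k₃ → k₂ = k₃

/-- A level `g·q = Q` with `4εq² < 1` gives offset invariance with generator `g` (`step8_povm_ceiling_dvd`).
[cite: ChenQuantumLattice2024, Lemma 3.13 pp. 32–34, eq. (35) p. 31] -/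
theorem offsetInvariant_dvd (h : S.Admissible) {κ : Type*} [Fintype κ] [DecidableEq κ]
    (U : Finset (Fin (S.n + 1))) (t₁ : Fin S.n) (ht₁ : t₁.succ ∈ U)
    (E : POVM (Fin (S.n + 1) → ZMod S.M) κ) {ε : ℝ} {g q : ℕ} (hgq : g * q = (S.Q : ℕ))
    (hε : 4 * ε * (q : ℝ) ^ 2 < 1) (hE : S.AlmostSureOn ε U E) : S.OffsetInvariant U E ε g :=
  fun _ _ _ hI₂ a m hm0 hmU hv _ _ hk₂ hk₃ =>
    S.step8_povm_ceiling_dvd h U t₁ ht₁ E hgq hε hE hI₂ a m hm0 hmU hv hk₂ hk₃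

/-- A level `g·q = Q` with `4εq² < 1` gives slope invariance with generator `g`
(`sameOutcome_same_offset_dvd`). [cite: ChenQuantumLattice2024, Lemma 3.13 pp. 32–34, eq. (35) p. 31] -/
theorem slopeInvariant_dvd (h : S.Admissible) {κ : Type*} [Fintype κ] [DecidableEq κ]
    (U : Finset (Fin (S.n + 1))) (E : POVM (Fin (S.n + 1) → ZMod S.M) κ) {ε : ℝ} {g q : ℕ}
    (hgq : g * q = (S.Q : ℕ)) (hε : 4 * ε * (q : ℝ) ^ 2 < 1) : S.SlopeInvariant U E ε g :=
  fun _ _ _ hI₂ hI₃ hbg _ _ hk₂ hk₃ =>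
    sameOutcome_same_offset_dvd h E hgq hε hI₂.2 hI₃.2 hbg hk₂ hk₃

/-- Generator `0`: an offset shift by `0` does not change the state. [cite: ChenQuantumLattice2024, eq. (35) p. 31] -/
theorem offsetInvariant_zero {κ : Type*} [Fintype κ] [DecidableEq κ]
    (U : Finset (Fin (S.n + 1))) (E : POVM (Fin (S.n + 1) → ZMod S.M) κ) {ε : ℝ} (hε2 : ε < 1 / 2) :
    S.OffsetInvariant U E ε 0 := by
  intro b₂ v₂ v₃ hI₂ a m hm0 hmU hv k₂ k₃ hk₂ hk₃
  have hcong : ∀ i, ((v₃ i : ℤ) : ZMod S.M) = ((v₂ i : ℤ) : ZMod S.M) := fun i => by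
    rw [hv i]
    congr 1
    ring
  have hstate : (S.inst b₂ v₃).phi7d = (S.inst b₂ v₂).phi7d := S.phi7d_inst_congr b₂ v₂ v₃ hcong
  rw [hstate] at hk₃
  exact E.almostCertain_unique hε2 ((S.inst b₂ v₂).phi7d_ne_zero hI₂.2) hk₂ hk₃

/-- Generator `0`: `b`'s congruent modulo `0` are equal. [cite: ChenQuantumLattice2024, eq. (35) p. 31] -/
theorem slopeInvariant_zero {κ : Type*} [Fintype κ] [DecidableEq κ]
    (U : Finset (Fin (S.n + 1))) (E : POVM (Fin (S.n + 1) → ZMod S.M) κ) {ε : ℝ} (hε2 : ε < 1 / 2) :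
    S.SlopeInvariant U E ε 0 := by
  intro b₂ b₃ w hI₂ hI₃ hbg k₂ k₃ hk₂ hk₃
  have hb : b₂ = b₃ := by
    funext i
    rcases Fin.eq_zero_or_eq_succ i with rfl | ⟨t, rfl⟩
    · have h2 : b₂ 0 = -1 := hI₂.2.b_head
      have h3 : b₃ 0 = -1 := hI₃.2.b_head
      rw [h2, h3]
    · obtain ⟨c, hc⟩ := hbg t.succ (Fin.succ_ne_zero t)
      linear_combination hc
  subst hb
  exact E.almostCertain_unique hε2 ((S.inst b₂ w).phi7d_ne_zero hI₂.2) hk₂ hk₃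

/-- Bezout closure of offset invariance: generators `G₁, G₂` give `x·G₁ + y·G₂` (through the intermediate
class instance `(b₂, v₂ + 2D²p₁G₁·x(a·b₂ + m))`). [cite: ChenQuantumLattice2024, Lemma 3.13 pp. 32–34, eq. (12) p. 17] -/
theorem offsetInvariant_comb (h : S.Admissible) {κ : Type*} [Fintype κ] [DecidableEq κ]
    {U : Finset (Fin (S.n + 1))} {E : POVM (Fin (S.n + 1) → ZMod S.M) κ} {ε : ℝ}
    (hE : S.AlmostSureOn ε U E) {G₁ G₂ : ℤ} (h₁ : S.OffsetInvariant U E ε G₁)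
    (h₂ : S.OffsetInvariant U E ε G₂) (x y : ℤ) : S.OffsetInvariant U E ε (x * G₁ + y * G₂) := by
  intro b₂ v₂ v₃ hI₂ a m hm0 hmU hv k₂ k₃ hk₂ hk₃
  obtain ⟨hb₂U, a₂⟩ := hI₂
  have hb₂0 : b₂ 0 = -1 := a₂.b_head
  let w : Fin (S.n + 1) → ℤ := fun i =>
    v₂ i + 2 * (S.D : ℤ) * S.D * S.p₁ * G₁ * (x * a * b₂ i + x * m i)
  have hw : ∀ i, (S.D : ℤ) ∣ w i := fun i =>
    dvd_add (a₂.v'_in_DZ i) ⟨2 * S.D * S.p₁ * G₁ * (x * a * b₂ i + x * m i), by ring⟩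
  have aw : (S.inst b₂ w).Admissible := S.inst_admissible h hb₂0 a₂.b_tail hw
  obtain ⟨o, ho⟩ := hE b₂ w ⟨hb₂U, aw⟩
  have l₁ : k₂ = o :=
    h₁ ⟨hb₂U, a₂⟩ (x * a) (fun i => x * m i) (by show x * m 0 = 0; rw [hm0, mul_zero])
      (fun i hi => by show x * m i = 0; rw [hmU i hi, mul_zero]) (fun i => rfl) hk₂ ho
  have l₂ : o = k₃ :=
    h₂ ⟨hb₂U, aw⟩ (y * a) (fun i => y * m i) (by show y * m 0 = 0; rw [hm0, mul_zero])
      (fun i hi => by show y * m i = 0; rw [hmU i hi, mul_zero])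
      (fun i => by
        rw [hv i]
        show _ = (((v₂ i + 2 * (S.D : ℤ) * S.D * S.p₁ * G₁ * (x * a * b₂ i + x * m i))
            + 2 * (S.D : ℤ) * S.D * S.p₁ * G₂ * (y * a * b₂ i + y * m i) : ℤ) : ZMod S.M)
        congr 1
        ring) ho hk₃
  rw [l₁, l₂]

/-- Bezout closure of slope invariance: generators `G₁, G₂` give `x·G₁ + y·G₂` (through an intermediate
`b′` of the class). [cite: ChenQuantumLattice2024, Lemma 3.13 pp. 32–34, eq. (12) p. 17] -/
theorem slopeInvariant_comb (h : S.Admissible) {κ : Type*} [Fintype κ] [DecidableEq κ]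
    {U : Finset (Fin (S.n + 1))} {E : POVM (Fin (S.n + 1) → ZMod S.M) κ} {ε : ℝ}
    (hE : S.AlmostSureOn ε U E) {G₁ G₂ : ℤ} (h₁ : S.SlopeInvariant U E ε G₁)
    (h₂ : S.SlopeInvariant U E ε G₂) (x y : ℤ) : S.SlopeInvariant U E ε (x * G₁ + y * G₂) := by
  classical
  intro b₂ b₃ w hI₂ hI₃ hbg k₂ k₃ hk₂ hk₃
  obtain ⟨hb₂U, a₂⟩ := hI₂
  obtain ⟨hb₃U, a₃⟩ := hI₃
  have hb₂0 : b₂ 0 = -1 := a₂.b_head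
  have hν : ∀ i : Fin (S.n + 1), ∃ ν : ℤ, i ≠ 0 → b₂ i - b₃ i = 2 * (S.p₁ : ℤ) * (x * G₁ + y * G₂) * ν := by
    intro i
    by_cases hi : i = 0
    · exact ⟨0, fun h' => absurd hi h'⟩
    · obtain ⟨ν, hν⟩ := hbg i hi
      exact ⟨ν, fun _ => hν⟩
  choose ν hν using hν
  let b' : Fin (S.n + 1) → ℤ := fun i =>
    if i ∈ U ∧ i ≠ 0 then b₂ i - 2 * (S.p₁ : ℤ) * G₁ * (x * ν i) else b₂ i
  have hw : ∀ i, (S.D : ℤ) ∣ w i := a₂.v'_in_DZ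
  have a' : (S.inst b' w).Admissible := by
    refine S.inst_admissible h ?_ (fun i hi => ?_) hw
    · show (if (0 : Fin (S.n + 1)) ∈ U ∧ (0 : Fin (S.n + 1)) ≠ 0 then _ else b₂ 0) = -1
      rw [if_neg (fun hc => hc.2 rfl), hb₂0]
    · show (2 * (S.p₁ : ℤ)) ∣ (if i ∈ U ∧ i ≠ 0 then b₂ i - 2 * (S.p₁ : ℤ) * G₁ * (x * ν i) else b₂ i)
      split_ifs
      · exact dvd_sub (a₂.b_tail i hi) ⟨G₁ * (x * ν i), by ring⟩
      · exact a₂.b_tail i hi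
  have c' : S.InClass U b' w := by
    refine ⟨fun i hi => ?_, a'⟩
    show (if i ∈ U ∧ i ≠ 0 then _ else b₂ i) = S.b i
    rw [if_neg (fun hc => hi hc.1), hb₂U i hi]
  obtain ⟨o, ho⟩ := hE b' w c'
  have l₁ : k₂ = o := by
    refine h₁ ⟨hb₂U, a₂⟩ c' (fun i hi => ?_) hk₂ ho
    show (2 * (S.p₁ : ℤ) * G₁) ∣
      b₂ i - (if i ∈ U ∧ i ≠ 0 then b₂ i - 2 * (S.p₁ : ℤ) * G₁ * (x * ν i) else b₂ i)
    split_ifs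
    · exact ⟨x * ν i, by ring⟩
    · exact ⟨0, by ring⟩
  have l₂ : o = k₃ := by
    refine h₂ c' ⟨hb₃U, a₃⟩ (fun i hi => ?_) ho hk₃
    show (2 * (S.p₁ : ℤ) * G₂) ∣
      (if i ∈ U ∧ i ≠ 0 then b₂ i - 2 * (S.p₁ : ℤ) * G₁ * (x * ν i) else b₂ i) - b₃ i
    split_ifs with hc
    · exact ⟨y * ν i, by linear_combination hν i hi⟩
    · have hiU : i ∉ U := fun hu => hc ⟨hu, hi⟩
      rw [hb₂U i hiU, hb₃U i hiU, sub_self]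
      exact dvd_zero _
  rw [l₁, l₂]

/-- Offset invariance for every `ℤ`-combination of a family of generators.
[cite: ChenQuantumLattice2024, Lemma 3.13 pp. 32–34, eq. (12) p. 17] -/
theorem offsetInvariant_sum (h : S.Admissible) {κ : Type*} [Fintype κ] [DecidableEq κ]
    {U : Finset (Fin (S.n + 1))} {E : POVM (Fin (S.n + 1) → ZMod S.M) κ} {ε : ℝ}
    (hE : S.AlmostSureOn ε U E) (hε2 : ε < 1 / 2) {ι : Type*} (t : Finset ι) (G c : ι → ℤ)
    (hG : ∀ i ∈ t, S.OffsetInvariant U E ε (G i)) :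
    S.OffsetInvariant U E ε (∑ i ∈ t, c i * G i) := by
  classical
  induction t using Finset.induction_on with
  | empty =>
    rw [Finset.sum_empty]
    exact S.offsetInvariant_zero U E hε2
  | insert i t hi ih =>
    rw [Finset.sum_insert hi]
    have key := S.offsetInvariant_comb h hE (hG i (Finset.mem_insert_self i t))
      (ih fun j hj => hG j (Finset.mem_insert_of_mem hj)) (c i) 1
    rwa [one_mul] at key

/-- Slope invariance for every `ℤ`-combination of a family of generators.
[cite: ChenQuantumLattice2024, Lemma 3.13 pp. 32–34, eq. (12) p. 17] -/
theorem slopeInvariant_sum (h : S.Admissible) {κ : Type*} [Fintype κ] [DecidableEq κ]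
    {U : Finset (Fin (S.n + 1))} {E : POVM (Fin (S.n + 1) → ZMod S.M) κ} {ε : ℝ}
    (hE : S.AlmostSureOn ε U E) (hε2 : ε < 1 / 2) {ι : Type*} (t : Finset ι) (G c : ι → ℤ)
    (hG : ∀ i ∈ t, S.SlopeInvariant U E ε (G i)) :
    S.SlopeInvariant U E ε (∑ i ∈ t, c i * G i) := by
  classical
  induction t using Finset.induction_on with
  | empty =>
    rw [Finset.sum_empty]
    exact S.slopeInvariant_zero U E hε2
  | insert i t hi ih =>
    rw [Finset.sum_insert hi]
    have key := S.slopeInvariant_comb h hE (hG i (Finset.mem_insert_self i t))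
      (ih fun j hj => hG j (Finset.mem_insert_of_mem hj)) (c i) 1
    rwa [one_mul] at key

/-- **The robust ceiling from a Bezout family of levels.**  Public data fixed, `U ∋ t₁+1`, `E` any POVM
`ε`-almost sure on the class, `(qᵢ)_{i∈t}` divisors of `Q` with `4ε·qᵢ² < 1` for every `i` and integers
`cᵢ` with `∑ cᵢ·(Q/qᵢ) = 1`.  Then the full conclusion of `step8_povm_ceiling_robust` holds: the
almost-certain outcome is the same on `(b₂,v₂)` and `(b₃,v₃)` whenever `v₃ ≡ v₂ + 2D²p₁(a·b₂ + m) (mod M)`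
(`a ∈ ℤ`, `m` supported on `U ∖ {0}`), for any `b₃` of the class.  Adjudication (b2b Part 1, gen 8).
[cite: ChenQuantumLattice2024, Lemma 3.13 pp. 32–34, eq. (12) p. 17, eq. (35) p. 31, Cond. C.3 p. 18][cite: NielsenChuang2010, §2.2.6 p. 90] -/
theorem step8_povm_ceiling_family (h : S.Admissible) {κ : Type*} [Fintype κ] [DecidableEq κ]
    (U : Finset (Fin (S.n + 1))) (t₁ : Fin S.n) (ht₁ : t₁.succ ∈ U)
    (E : POVM (Fin (S.n + 1) → ZMod S.M) κ) {ε : ℝ} {ι : Type*} (t : Finset ι) (q : ι → ℕ)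
    (hq : ∀ i ∈ t, q i ∣ (S.Q : ℕ) ∧ 4 * ε * (q i : ℝ) ^ 2 < 1) (c : ι → ℤ)
    (hc : ∑ i ∈ t, c i * (((S.Q : ℕ) / q i : ℕ) : ℤ) = 1) (hE : S.AlmostSureOn ε U E)
    {b₂ v₂ b₃ v₃ : Fin (S.n + 1) → ℤ} (hI₂ : S.InClass U b₂ v₂) (hI₃ : S.InClass U b₃ v₃)
    (a : ℤ) (m : Fin (S.n + 1) → ℤ) (hm0 : m 0 = 0) (hmU : ∀ i, i ∉ U → m i = 0)
    (hv : ∀ i, ((v₃ i : ℤ) : ZMod S.M)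
      = ((v₂ i + 2 * (S.D : ℤ) * S.D * S.p₁ * (a * b₂ i + m i) : ℤ) : ZMod S.M))
    {k₂ k₃ : κ} (hk₂ : E.AlmostCertain ε (S.inst b₂ v₂).phi7d k₂)
    (hk₃ : E.AlmostCertain ε (S.inst b₃ v₃).phi7d k₃) :
    k₂ = k₃ := by
  classical
  obtain ⟨hb₂U, a₂⟩ := hI₂
  obtain ⟨hb₃U, a₃⟩ := hI₃
  have hb₂0 : b₂ 0 = -1 := a₂.b_head
  have hb₃0 : b₃ 0 = -1 := a₃.b_head
  -- `t` is nonempty, hence `ε < 1/2`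
  have hne : t.Nonempty := by
    rw [Finset.nonempty_iff_ne_empty]
    rintro rfl
    rw [Finset.sum_empty] at hc
    exact zero_ne_one hc
  obtain ⟨i₀, hi₀⟩ := hne
  have hq1 : (1 : ℝ) ≤ q i₀ := by
    have h0 : q i₀ ≠ 0 := by
      intro h0
      have := (hq i₀ hi₀).1
      rw [h0, zero_dvd_iff] at this
      exact S.Q.ne_zero this
    exact_mod_cast Nat.one_le_iff_ne_zero.2 h0
  have hε2 : ε < 1 / 2 := eps_lt_half_of_sq hq1 (hq i₀ hi₀).2
  -- the two invariances with generator `1`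
  have hoff : S.OffsetInvariant U E ε 1 := by
    rw [← hc]
    refine S.offsetInvariant_sum h hE hε2 t (fun i => (((S.Q : ℕ) / q i : ℕ) : ℤ)) c fun i hi => ?_
    exact S.offsetInvariant_dvd h U t₁ ht₁ E (Nat.div_mul_cancel (hq i hi).1) (hq i hi).2 hE
  have hslope : S.SlopeInvariant U E ε 1 := by
    rw [← hc]
    refine S.slopeInvariant_sum h hE hε2 t (fun i => (((S.Q : ℕ) / q i : ℕ) : ℤ)) c fun i hi => ?_
    exact S.slopeInvariant_dvd h U E (Nat.div_mul_cancel (hq i hi).1) (hq i hi).2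
  -- `(b₂,v₂) → (b₂,w) → (b₃,w) ~ (b₃,v₃)`
  let w : Fin (S.n + 1) → ℤ := fun i => v₂ i + 2 * (S.D : ℤ) * S.D * S.p₁ * (a * b₂ i + m i)
  have hw : ∀ i, (S.D : ℤ) ∣ w i := fun i =>
    dvd_add (a₂.v'_in_DZ i) ⟨2 * S.D * S.p₁ * (a * b₂ i + m i), by ring⟩
  have aw₂ : (S.inst b₂ w).Admissible := S.inst_admissible h hb₂0 a₂.b_tail hw
  have aw₃ : (S.inst b₃ w).Admissible := S.inst_admissible h hb₃0 a₃.b_tail hw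
  obtain ⟨o₂, ho₂⟩ := hE b₂ w ⟨hb₂U, aw₂⟩
  obtain ⟨o₃, ho₃⟩ := hE b₃ w ⟨hb₃U, aw₃⟩
  have l₁ : k₂ = o₂ :=
    hoff ⟨hb₂U, a₂⟩ a m hm0 hmU (fun i => by
      show ((v₂ i + 2 * (S.D : ℤ) * S.D * S.p₁ * (a * b₂ i + m i) : ℤ) : ZMod S.M) = _
      congr 1
      ring) hk₂ ho₂
  have l₂ : o₂ = o₃ :=
    hslope ⟨hb₂U, aw₂⟩ ⟨hb₃U, aw₃⟩ (fun i hi => by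
      rw [mul_one]
      have t₂ : (2 * (S.p₁ : ℤ)) ∣ b₂ i := a₂.b_tail i hi
      have t₃ : (2 * (S.p₁ : ℤ)) ∣ b₃ i := a₃.b_tail i hi
      exact dvd_sub t₂ t₃) ho₂ ho₃
  have hcong : ∀ i, ((w i : ℤ) : ZMod S.M) = ((v₃ i : ℤ) : ZMod S.M) := fun i => (hv i).symm
  have hstate : (S.inst b₃ w).phi7d = (S.inst b₃ v₃).phi7d := S.phi7d_inst_congr b₃ v₃ w hcong
  rw [← hstate] at hk₃
  have l₃ : o₃ = k₃ := E.almostCertain_unique hε2 ((S.inst b₃ w).phi7d_ne_zero aw₃) ho₃ hk₃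
  rw [l₁, l₂, l₃]

/-- **Pairwise coprime factorisation** (`Q = ∏_{i∈t} qᵢ`, e.g. `Q = p₂⋯p_κ` of Cond. C.3): if `4ε·qᵢ² < 1`
for every factor, the full conclusion of the robust ceiling holds — tolerance `4ε·(max qᵢ)² < 1`, i.e.
inverse-POLYLOGARITHMIC in `n` for the source's parameters (`pᵢ ≤ log n`).  Adjudication (gen 8).
[cite: ChenQuantumLattice2024, Lemma 3.13 pp. 32–34, Cond. C.3 p. 18, §3.2 p. 19][cite: NielsenChuang2010, §2.2.6 p. 90] -/
theorem step8_povm_ceiling_pairwiseCoprime (h : S.Admissible) {κ : Type*} [Fintype κ] [DecidableEq κ]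
    (U : Finset (Fin (S.n + 1))) (t₁ : Fin S.n) (ht₁ : t₁.succ ∈ U)
    (E : POVM (Fin (S.n + 1) → ZMod S.M) κ) {ε : ℝ} {ι : Type*} (t : Finset ι) (q : ι → ℕ)
    (hprod : ∏ i ∈ t, q i = (S.Q : ℕ)) (hcop : (t : Set ι).Pairwise fun i j => Nat.Coprime (q i) (q j))
    (hεq : ∀ i ∈ t, 4 * ε * (q i : ℝ) ^ 2 < 1) (hE : S.AlmostSureOn ε U E)
    {b₂ v₂ b₃ v₃ : Fin (S.n + 1) → ℤ} (hI₂ : S.InClass U b₂ v₂) (hI₃ : S.InClass U b₃ v₃)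
    (a : ℤ) (m : Fin (S.n + 1) → ℤ) (hm0 : m 0 = 0) (hmU : ∀ i, i ∉ U → m i = 0)
    (hv : ∀ i, ((v₃ i : ℤ) : ZMod S.M)
      = ((v₂ i + 2 * (S.D : ℤ) * S.D * S.p₁ * (a * b₂ i + m i) : ℤ) : ZMod S.M))
    {k₂ k₃ : κ} (hk₂ : E.AlmostCertain ε (S.inst b₂ v₂).phi7d k₂)
    (hk₃ : E.AlmostCertain ε (S.inst b₃ v₃).phi7d k₃) :
    k₂ = k₃ := by
  classical
  have hne : t.Nonempty := by
    rw [Finset.nonempty_iff_ne_empty]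
    rintro rfl
    rw [Finset.prod_empty] at hprod
    have h3 : 3 ≤ (S.Q : ℕ) := h.three_le_Q
    omega
  have hpw : Pairwise (Function.onFun IsCoprime fun i : t => (q i : ℤ)) := by
    intro i j hij
    exact Nat.isCoprime_iff_coprime.2 (hcop i.2 j.2 fun heq => hij (Subtype.ext heq))
  obtain ⟨μ, hμ⟩ := (exists_sum_eq_one_iff_pairwise_coprime (s := fun i => (q i : ℤ)) hne).2 hpw
  have hdvd : ∀ i ∈ t, q i ∣ (S.Q : ℕ) := fun i hi => by
    rw [← hprod]
    exact Finset.dvd_prod_of_mem q hi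
  have hcof : ∀ i ∈ t, (∏ j ∈ t \ {i}, (q j : ℤ)) = (((S.Q : ℕ) / q i : ℕ) : ℤ) := by
    intro i hi
    have hqi : q i ≠ 0 := by
      intro h0
      have := hdvd i hi
      rw [h0, zero_dvd_iff] at this
      exact S.Q.ne_zero this
    have key : (∏ j ∈ t \ {i}, q j) * q i = (S.Q : ℕ) := by
      rw [Finset.sdiff_singleton_eq_erase, Finset.prod_erase_mul _ _ hi, hprod]
    rw [Nat.div_eq_of_eq_mul_left (Nat.pos_of_ne_zero hqi) key.symm]
    push_cast
    rfl
  refine S.step8_povm_ceiling_family h U t₁ ht₁ E t q (fun i hi => ⟨hdvd i hi, hεq i hi⟩) μ ?_ hE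
    hI₂ hI₃ a m hm0 hmU hv hk₂ hk₃
  rw [← hμ]
  exact Finset.sum_congr rfl fun i hi => by rw [hcof i hi]

end Shape

end Literature.Computability.Cryptography.Chen2024
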